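import Literature.Computability.MetaComplexity.LevelledRefutationCNFRestriction
import Literature.Computability.MetaComplexity.LevelledRefutationCNFToolkit
import HarnessLib

/-!
# Garlík's random restriction for `REF^F_{s,t}`: the probability estimates

Support file for the proof of `levelledRefCNF_lowerBound` ([Garlík 2019, Thm 1]); second part
of the probabilistic half of [Garlík 2019, §4]. On the sample space `Ω P` of
`LevelledRefutationCNFRestriction.lean` we put the product distribution `dist` (selection bits
Bernoulli(`p`), signs fair coins, proposed values uniform) and bound the probabilities of the
bad events:

* the level counts ([Garlík 2019, Lemma 10]) by the Chernoff bound;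
* for a fixed clause `E` and level `i`, "`E` is not satisfied by `ρ(ω)` although more than `W`
  pairs of level `i` are `D`-mentioned / `V`-, `I`-important in `E`" by the product rule after
  conditioning on the other blocks ([Garlík 2019, Lemma 14 (i)–(iii)]), and the same with
  `L`-, `R`-importance by the sequential bound ([Garlík 2019, Lemma 14 (iv)–(v)]), and the
  column events ([Garlík 2019, Lemma 14 (vi)–(vii)]);
* the union bound then yields a sample whose restriction is admissible, sparse, and makes every
  clause of a given family satisfied or narrow (`exists_good_sample`), provided an explicit sum
  of failure probabilities is `< 1`.

## References

* M. Garlík, *Resolution lower bounds for refutation statements*, MFCS 2019 / arXiv:1905.12372,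
  §4, Lemmas 10 and 14.
-/

namespace Literature.Computability.MetaComplexity

open _root_.Computability Complexity Finset

namespace LevelledRefCNF

/-! ### More on `FinProb` -/

namespace FinProb

variable {α β : Type*} [Fintype α] [Fintype β]

/-- Probability of the complement. [folklore] -/
theorem pr_not (μ : FinProb α) (A : α → Prop) : μ.pr (fun a => ¬ A a) = 1 - μ.pr A := by
  classical
  have h : μ.ex (fun a => (if ¬ A a then (1 : ℝ) else 0) + (if A a then (1 : ℝ) else 0)) =
      μ.ex (fun _ => (1 : ℝ)) := by
    congr 1
    funext a
    by_cases hA : A a <;> simp [hA]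
  rw [μ.ex_const, ex_add] at h
  rw [pr_eq_ex, pr_eq_ex]
  linarith

/-- Probability of a rectangle in a binary product. [folklore] -/
theorem pr_prod_and (μ : FinProb α) (ν : FinProb β) (B : α → Prop) (C : β → Prop) :
    (μ.prod ν).pr (fun x => B x.1 ∧ C x.2) = μ.pr B * ν.pr C := by
  classical
  rw [pr_eq_ex, ex_prod, pr_eq_ex, pr_eq_ex]
  unfold ex
  rw [sum_mul]
  refine sum_congr rfl fun a _ => ?_
  by_cases hB : B a
  · simp only [hB, true_and, if_true, mul_one]
  · simp [hB]

/-- Probability of a coordinate event in a finite product. [folklore] -/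
theorem pr_pi_coord {ι : Type*} [Fintype ι] [DecidableEq ι] {κ : Type*} [Fintype κ]
    (μ : ι → FinProb κ) (i : ι) (A : κ → Prop) :
    (pi μ).pr (fun f => A (f i)) = (μ i).pr A := by
  have := pr_pi_forall μ {i} (fun _ => A)
  simp only [mem_singleton, forall_eq, prod_singleton] at this
  exact this

/-- A product of factors in `[0, b]` is at most `b ^ card`. [folklore] -/
theorem prod_le_pow_of_le {ι : Type*} (s : Finset ι) {f : ι → ℝ} {b : ℝ} (h0 : ∀ i ∈ s, 0 ≤ f i)
    (hb : ∀ i ∈ s, f i ≤ b) : ∏ i ∈ s, f i ≤ b ^ s.card := by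
  calc ∏ i ∈ s, f i ≤ ∏ _i ∈ s, b := prod_le_prod h0 hb
    _ = b ^ s.card := prod_const b

end FinProb

/-! ### The distribution of the sample -/

/-- The numeric data of the distribution: the selection probability `p ∈ [0,1]`, and
positivity of `n, r, t` (so that the uniform distributions make sense).
[cite: Garlik2019, §4 (the parameter p)] -/
structure ProbParams (P : Params) where
  /-- the selection probability -/
  p : ℝ
  /-- `0 ≤ p` -/
  p_nonneg : 0 ≤ p
  /-- `p ≤ 1` -/
  p_le_one : p ≤ 1
  /-- `n > 0` -/
  n_pos : 0 < P.n
  /-- `r > 0` -/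
  r_pos : 0 < P.r
  /-- `t > 0` -/
  t_pos : 0 < P.t

namespace ProbParams

variable {P : Params} (π : ProbParams P)

/-- The selection coin. [cite: Garlik2019, Def. 9 ("with independent probability p")] -/
def coin : FinProb Bool := FinProb.bernoulli π.p π.p_nonneg π.p_le_one

/-- A fair coin (the random sign of a literal). [cite: Garlik2019, Def. 9 ("with probability
1/2 choose between including the literal x_ℓ or ¬x_ℓ")] -/
noncomputable def fair : FinProb Bool := FinProb.bernoulli (1 / 2) (by norm_num) (by norm_num)

/-- Distribution of the `D`-data of a pair. [cite: Garlik2019, Def. 9 (first item)] -/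
noncomputable def μD : FinProb (Bool × (Fin P.n → Bool)) :=
  π.coin.prod (FinProb.pi fun _ : Fin P.n => fair)

/-- Distribution of the `V`-data of a pair. [cite: Garlik2019, Def. 9 (third item)] -/
noncomputable def μV : FinProb (Bool × Fin P.n) :=
  haveI : Nonempty (Fin P.n) := ⟨⟨0, π.n_pos⟩⟩
  π.coin.prod (FinProb.uniform (Fin P.n))

/-- Distribution of the `I`-data of a position. [cite: Garlik2019, Def. 9 (second item)] -/
noncomputable def μI : FinProb (Bool × Fin P.r) :=
  haveI : Nonempty (Fin P.r) := ⟨⟨0, π.r_pos⟩⟩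
  π.coin.prod (FinProb.uniform (Fin P.r))

/-- Distribution of the `RL`-data of a pair. [cite: Garlik2019, Def. 9 (fourth item)] -/
noncomputable def μβ : FinProb (Bool × (Fin P.t × Fin P.t)) :=
  haveI : Nonempty (Fin P.t × Fin P.t) := ⟨(⟨0, π.t_pos⟩, ⟨0, π.t_pos⟩)⟩
  π.coin.prod (FinProb.uniform (Fin P.t × Fin P.t))

/-- Distribution of the `D`-block. [cite: Garlik2019, Def. 9] -/
noncomputable def distD : FinProb (ΩD P) := FinProb.pi fun _ => π.μD

/-- Distribution of the `V`-block. [cite: Garlik2019, Def. 9] -/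
noncomputable def distV : FinProb (ΩV P) := FinProb.pi fun _ => π.μV

/-- Distribution of the `I`-block. [cite: Garlik2019, Def. 9] -/
noncomputable def distI : FinProb (ΩI P) := FinProb.pi fun _ => π.μI

/-- Distribution of one level of the `RL`-block. [cite: Garlik2019, Def. 9] -/
noncomputable def distLevel : FinProb (Fin P.t → Bool × (Fin P.t × Fin P.t)) :=
  FinProb.pi fun _ => π.μβ

/-- Distribution of the `RL`-block. [cite: Garlik2019, Def. 9] -/
noncomputable def distRL : FinProb (ΩRL P) := FinProb.pi fun _ => π.distLevel

/-- **The distribution of the sample** (all coordinates independent).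
[cite: Garlik2019, Def. 9] -/
noncomputable def dist : FinProb (Ω P) := ((π.distD.prod π.distV).prod π.distI).prod π.distRL

/-! #### Elementary probabilities of the factors -/

/-- The selection coin succeeds with probability `p`. [folklore] -/
theorem pr_coin : π.coin.pr (fun b => b = true) = π.p :=
  FinProb.pr_bernoulli_true _ _

/-- A fair coin shows a given face with probability `1/2`. [folklore] -/
theorem pr_fair (v : Bool) : (fair).pr (fun b => b = v) = 1 / 2 := by
  classical
  unfold fair
  rw [FinProb.pr_eq_ex, FinProb.ex_bernoulli]
  cases v <;> norm_num

/-- `D`-data: selected with a prescribed sign at a prescribed variable, probability `p/2`.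
[cite: Garlik2019, Lemma 14 (proof of (i): "such a literal is satisfied by ρ with probability
at least p/2")] -/
theorem pr_μD (ℓ : Fin P.n) (v : Bool) :
    π.μD.pr (fun x => x.1 = true ∧ x.2 ℓ = v) = π.p / 2 := by
  unfold μD
  have h := FinProb.pr_prod_and π.coin (FinProb.pi fun _ : Fin P.n => fair) (fun b => b = true)
    (fun f : Fin P.n → Bool => f ℓ = v)
  rw [h, pr_coin, FinProb.pr_pi_coord (fun _ : Fin P.n => fair) ℓ (· = v), pr_fair]
  ring

/-- `V`-data: selected with a value in a set of at least half the values, probability `≥ p/2`.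
[cite: Garlik2019, Lemma 14 (proof of (iii))] -/
theorem le_pr_μV (G : Finset (Fin P.n)) (hG : P.n ≤ 2 * G.card) :
    π.p / 2 ≤ π.μV.pr (fun x => x.1 = true ∧ x.2 ∈ G) := by
  classical
  haveI : Nonempty (Fin P.n) := ⟨⟨0, π.n_pos⟩⟩
  unfold μV
  have h' := FinProb.pr_prod_and π.coin (FinProb.uniform (Fin P.n)) (fun b => b = true) (· ∈ G)
  rw [h', pr_coin]
  have h : (1 : ℝ) / 2 ≤ (FinProb.uniform (Fin P.n)).pr (· ∈ G) := by
    apply FinProb.le_pr_uniform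
    rw [Fintype.card_fin, filter_mem_eq_inter, univ_inter]
    have : (P.n : ℝ) ≤ 2 * G.card := by exact_mod_cast hG
    linarith
  calc π.p / 2 = π.p * (1 / 2) := by ring
    _ ≤ π.p * (FinProb.uniform (Fin P.n)).pr (· ∈ G) := mul_le_mul_of_nonneg_left h π.p_nonneg

/-- `V`-data: selected with a prescribed value, probability `p/n`.
[cite: Garlik2019, Lemma 14 (proof of (vii))] -/
theorem pr_μV_eq (ℓ : Fin P.n) : π.μV.pr (fun x => x.1 = true ∧ x.2 = ℓ) = π.p / P.n := by
  classical
  haveI : Nonempty (Fin P.n) := ⟨⟨0, π.n_pos⟩⟩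
  unfold μV
  have h' := FinProb.pr_prod_and π.coin (FinProb.uniform (Fin P.n)) (fun b => b = true) (· = ℓ)
  rw [h', pr_coin, FinProb.pr_uniform, Fintype.card_fin]
  rw [show (univ.filter fun x : Fin P.n => x = ℓ) = {ℓ} by ext; simp]
  simp only [card_singleton, Nat.cast_one]
  ring

/-- `I`-data: selected with a value in a set of at least half the values, probability `≥ p/2`.
[cite: Garlik2019, Lemma 14 (proof of (ii))] -/
theorem le_pr_μI (G : Finset (Fin P.r)) (hG : P.r ≤ 2 * G.card) :
    π.p / 2 ≤ π.μI.pr (fun x => x.1 = true ∧ x.2 ∈ G) := by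
  classical
  haveI : Nonempty (Fin P.r) := ⟨⟨0, π.r_pos⟩⟩
  unfold μI
  have h' := FinProb.pr_prod_and π.coin (FinProb.uniform (Fin P.r)) (fun b => b = true) (· ∈ G)
  rw [h', pr_coin]
  have h : (1 : ℝ) / 2 ≤ (FinProb.uniform (Fin P.r)).pr (· ∈ G) := by
    apply FinProb.le_pr_uniform
    rw [Fintype.card_fin, filter_mem_eq_inter, univ_inter]
    have : (P.r : ℝ) ≤ 2 * G.card := by exact_mod_cast hG
    linarith
  calc π.p / 2 = π.p * (1 / 2) := by ring
    _ ≤ π.p * (FinProb.uniform (Fin P.r)).pr (· ∈ G) := mul_le_mul_of_nonneg_left h π.p_nonneg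

/-- `I`-data: selected with a prescribed value, probability `p/r`.
[cite: Garlik2019, Lemma 14 (proof of (vi))] -/
theorem pr_μI_eq (m : Fin P.r) : π.μI.pr (fun x => x.1 = true ∧ x.2 = m) = π.p / P.r := by
  classical
  haveI : Nonempty (Fin P.r) := ⟨⟨0, π.r_pos⟩⟩
  unfold μI
  have h' := FinProb.pr_prod_and π.coin (FinProb.uniform (Fin P.r)) (fun b => b = true) (· = m)
  rw [h', pr_coin, FinProb.pr_uniform, Fintype.card_fin]
  rw [show (univ.filter fun x : Fin P.r => x = m) = {m} by ext; simp]
  simp only [card_singleton, Nat.cast_one]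
  ring

/-- `RL`-data: selected with the pair of proposals in a set of at least a quarter of all
pairs, probability `≥ p/4`. [cite: Garlik2019, Lemma 14 (proof of (iv): the factor 1/3,
here 1/4)] -/
theorem le_pr_μβ (G : Finset (Fin P.t × Fin P.t)) (hG : P.t * P.t ≤ 4 * G.card) :
    π.p / 4 ≤ π.μβ.pr (fun x => x.1 = true ∧ x.2 ∈ G) := by
  classical
  haveI : Nonempty (Fin P.t × Fin P.t) := ⟨(⟨0, π.t_pos⟩, ⟨0, π.t_pos⟩)⟩
  unfold μβ
  have h' := FinProb.pr_prod_and π.coin (FinProb.uniform (Fin P.t × Fin P.t)) (fun b => b = true)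
    (· ∈ G)
  rw [h', pr_coin]
  have h : (1 : ℝ) / 4 ≤ (FinProb.uniform (Fin P.t × Fin P.t)).pr (· ∈ G) := by
    apply FinProb.le_pr_uniform
    rw [Fintype.card_prod, Fintype.card_fin, filter_mem_eq_inter, univ_inter]
    have : ((P.t * P.t : ℕ) : ℝ) ≤ 4 * G.card := by exact_mod_cast hG
    push_cast at this ⊢
    linarith
  calc π.p / 4 = π.p * (1 / 4) := by ring
    _ ≤ π.p * (FinProb.uniform (Fin P.t × Fin P.t)).pr (· ∈ G) :=
        mul_le_mul_of_nonneg_left h π.p_nonneg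

/-- The selection coin of the compound data. [folklore] -/
theorem pr_μD_fst : π.μD.pr (fun x => x.1 = true) = π.p := by
  unfold μD
  have h := FinProb.pr_prod_fst π.coin (FinProb.pi fun _ : Fin P.n => fair) (fun b => b = true)
  rw [h, pr_coin]

/-- The selection coin of the compound data. [folklore] -/
theorem pr_μV_fst : π.μV.pr (fun x => x.1 = true) = π.p := by
  haveI : Nonempty (Fin P.n) := ⟨⟨0, π.n_pos⟩⟩
  unfold μV
  have h := FinProb.pr_prod_fst π.coin (FinProb.uniform (Fin P.n)) (fun b => b = true)
  rw [h, pr_coin]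

/-- The selection coin of the compound data. [folklore] -/
theorem pr_μI_fst : π.μI.pr (fun x => x.1 = true) = π.p := by
  haveI : Nonempty (Fin P.r) := ⟨⟨0, π.r_pos⟩⟩
  unfold μI
  have h := FinProb.pr_prod_fst π.coin (FinProb.uniform (Fin P.r)) (fun b => b = true)
  rw [h, pr_coin]

/-- The selection coin of the compound data. [folklore] -/
theorem pr_μβ_fst : π.μβ.pr (fun x => x.1 = true) = π.p := by
  haveI : Nonempty (Fin P.t × Fin P.t) := ⟨(⟨0, π.t_pos⟩, ⟨0, π.t_pos⟩)⟩
  unfold μβ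
  have h := FinProb.pr_prod_fst π.coin (FinProb.uniform (Fin P.t × Fin P.t)) (fun b => b = true)
  rw [h, pr_coin]

end ProbParams

/-! ### Reading the accessors on the blocks -/

section ReadBlocks

variable {P : Params}

/-- `selD` in range. [folklore] -/
theorem selD_eq (d : ΩD P) {i j : ℕ} (hi : i < P.s) (hj : j < P.t) :
    selD P d i j = (d (⟨i, hi⟩, ⟨j, hj⟩)).1 := by
  simp [selD, hi, hj]

/-- `signs` in range. [folklore] -/
theorem signs_eq (d : ΩD P) {i j ℓ : ℕ} (hi : i < P.s) (hj : j < P.t) (hℓ : ℓ < P.n) :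
    signs P d i j ℓ = (d (⟨i, hi⟩, ⟨j, hj⟩)).2 ⟨ℓ, hℓ⟩ := by
  simp [signs, hi, hj, hℓ]

/-- `selV` in range. [folklore] -/
theorem selV_eq (v : ΩV P) {i j : ℕ} (hi : i < P.s) (hj : j < P.t) :
    selV P v i j = (v (⟨i, hi⟩, ⟨j, hj⟩)).1 := by
  simp [selV, hi, hj]

/-- `valV` in range. [folklore] -/
theorem valV_eq (v : ΩV P) {i j : ℕ} (hi : i < P.s) (hj : j < P.t) :
    valV P v i j = ((v (⟨i, hi⟩, ⟨j, hj⟩)).2 : ℕ) := by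
  simp [valV, hi, hj]

/-- `selI` in range. [folklore] -/
theorem selI_eq (e : ΩI P) {j : ℕ} (hj : j < P.t) : selI P e j = (e ⟨j, hj⟩).1 := by
  simp [selI, hj]

/-- `valI` in range. [folklore] -/
theorem valI_eq (e : ΩI P) {j : ℕ} (hj : j < P.t) : valI P e j = ((e ⟨j, hj⟩).2 : ℕ) := by
  simp [valI, hj]

/-- The level slice of a set of positions, as a set of pairs. [folklore] -/
def slice (P : Params) {i : ℕ} (hi : i < P.s) (M : Finset ℕ) : Finset (Fin P.s × Fin P.t) :=
  univ.filter fun q => q.1 = ⟨i, hi⟩ ∧ (q.2 : ℕ) ∈ M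

/-- Membership in a slice. [folklore] -/
theorem mem_slice {i : ℕ} (hi : i < P.s) {M : Finset ℕ} {q : Fin P.s × Fin P.t} :
    q ∈ slice P hi M ↔ q.1 = ⟨i, hi⟩ ∧ (q.2 : ℕ) ∈ M := by
  simp [slice]

/-- A slice is as large as the set of positions it comes from (positions `< t`).
[folklore] -/
theorem le_card_slice {i : ℕ} (hi : i < P.s) {M : Finset ℕ} (ht : 0 < P.t)
    (hM : ∀ j ∈ M, j < P.t) : M.card ≤ (slice P hi M).card := by
  refine Finset.card_le_card_of_injOn (fun j => (⟨i, hi⟩, ⟨j % P.t, Nat.mod_lt _ ht⟩)) ?_ ?_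
  · intro j hj
    have hj' : j ∈ M := hj
    simp only [coe_filter, slice, Set.mem_setOf_eq, mem_univ, true_and]
    rw [Nat.mod_eq_of_lt (hM j hj')]
    exact hj'
  · intro j hj j' hj' h
    simp only [Prod.mk.injEq, Fin.mk.injEq, true_and] at h
    rwa [Nat.mod_eq_of_lt (hM j hj), Nat.mod_eq_of_lt (hM j' hj')] at h

/-- The positions of a set, as a subset of `Fin t`. [folklore] -/
def posSet (P : Params) (M : Finset ℕ) : Finset (Fin P.t) :=
  univ.filter fun j => (j : ℕ) ∈ M

/-- Membership in `posSet`. [folklore] -/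
theorem mem_posSet {M : Finset ℕ} {j : Fin P.t} : j ∈ posSet P M ↔ (j : ℕ) ∈ M := by
  simp [posSet]

/-- `posSet M` is as large as `M` (positions `< t`). [folklore] -/
theorem le_card_posSet {M : Finset ℕ} (ht : 0 < P.t) (hM : ∀ j ∈ M, j < P.t) :
    M.card ≤ (posSet P M).card := by
  refine Finset.card_le_card_of_injOn (fun j => (⟨j % P.t, Nat.mod_lt _ ht⟩ : Fin P.t)) ?_ ?_
  · intro j hj
    have hj' : j ∈ M := hj
    simp only [coe_filter, posSet, Set.mem_setOf_eq, mem_univ, true_and]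
    rw [Nat.mod_eq_of_lt (hM j hj')]
    exact hj'
  · intro j hj j' hj' h
    simp only [Fin.mk.injEq] at h
    rwa [Nat.mod_eq_of_lt (hM j hj), Nat.mod_eq_of_lt (hM j' hj')] at h

end ReadBlocks

/-! ### Conditioning on blocks -/

section Blocks

variable {P : Params} (π : ProbParams P)

/-- Conditioning on everything but the `D`-block. [folklore] -/
theorem pr_dist_le_D {A : Ω P → Prop} {c : ℝ}
    (h : ∀ (v : ΩV P) (e : ΩI P) (g : ΩRL P), π.distD.pr (fun d => A (((d, v), e), g)) ≤ c) :
    π.dist.pr A ≤ c := by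
  unfold ProbParams.dist
  refine FinProb.pr_prod_le_left _ _ fun g => ?_
  refine FinProb.pr_prod_le_left _ _ fun e => ?_
  exact FinProb.pr_prod_le_left _ _ fun v => h v e g

/-- Conditioning on everything but the `V`-block. [folklore] -/
theorem pr_dist_le_V {A : Ω P → Prop} {c : ℝ}
    (h : ∀ (d : ΩD P) (e : ΩI P) (g : ΩRL P), π.distV.pr (fun v => A (((d, v), e), g)) ≤ c) :
    π.dist.pr A ≤ c := by
  unfold ProbParams.dist
  refine FinProb.pr_prod_le_left _ _ fun g => ?_
  refine FinProb.pr_prod_le_left _ _ fun e => ?_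
  exact FinProb.pr_prod_le_right _ _ fun d => h d e g

/-- Conditioning on everything but the `I`-block. [folklore] -/
theorem pr_dist_le_I {A : Ω P → Prop} {c : ℝ}
    (h : ∀ (d : ΩD P) (v : ΩV P) (g : ΩRL P), π.distI.pr (fun e => A (((d, v), e), g)) ≤ c) :
    π.dist.pr A ≤ c := by
  unfold ProbParams.dist
  refine FinProb.pr_prod_le_left _ _ fun g => ?_
  exact FinProb.pr_prod_le_right _ _ fun x => h x.1 x.2 g

/-- Conditioning on everything but the `RL`-block. [folklore] -/
theorem pr_dist_le_RL {A : Ω P → Prop} {c : ℝ}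
    (h : ∀ (x : (ΩD P × ΩV P) × ΩI P), π.distRL.pr (fun g => A (x, g)) ≤ c) :
    π.dist.pr A ≤ c := by
  unfold ProbParams.dist
  exact FinProb.pr_prod_le_right _ _ fun x => h x

/-- Conditioning the `RL`-block on all levels but one. [folklore] -/
theorem pr_distRL_le_level {A : ΩRL P → Prop} {c : ℝ} (i : Fin P.s)
    (h : ∀ g : ΩRL P, π.distLevel.pr (fun lv => A (Function.update g i lv)) ≤ c) :
    π.distRL.pr A ≤ c := by
  unfold ProbParams.distRL
  exact FinProb.pr_pi_le_update _ i h

end Blocks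

/-! ### The level counts (Lemma 10) -/

section Counts

variable {P : Params} (π : ProbParams P)

/-- The pairs of level `i`. [folklore] -/
def levelPairs (P : Params) (i : Fin P.s) : Finset (Fin P.s × Fin P.t) :=
  univ.filter fun q => q.1 = i

/-- A level has at most `t` pairs. [folklore] -/
theorem card_levelPairs_le (i : Fin P.s) : (levelPairs P i).card ≤ P.t := by
  calc (levelPairs P i).card ≤ (univ : Finset (Fin P.t)).card :=
        Finset.card_le_card_of_injOn Prod.snd (fun _ _ => mem_univ _) (by
          rintro ⟨a, b⟩ ha ⟨a', b'⟩ ha' (h : b = b')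
          simp only [coe_filter, levelPairs, Set.mem_setOf_eq, mem_univ, true_and] at ha ha'
          rw [ha, ha', h])
    _ = P.t := by simp

/-- The `D`-selected positions of a level inject into the selected pairs of that level.
[folklore] -/
theorem card_selDSet_le (d : ΩD P) {i : ℕ} (hi : i < P.s) :
    (selDSet P d i).card ≤ ((levelPairs P ⟨i, hi⟩).filter fun q => (d q).1 = true).card := by
  have ht : ∀ j ∈ selDSet P d i, j < P.t := fun j hj => by
    simp only [selDSet, mem_filter, mem_range] at hj; exact hj.1
  by_cases ht0 : P.t = 0
  · have : selDSet P d i = ∅ := by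
      ext j; simp only [selDSet, mem_filter, mem_range, Finset.notMem_empty, iff_false]; omega
    rw [this]; simp
  refine (le_card_slice hi (Nat.pos_of_ne_zero ht0) ht).trans (Finset.card_le_card fun q hq => ?_)
  rw [mem_slice] at hq
  obtain ⟨h1, h2⟩ := hq
  simp only [selDSet, mem_filter, mem_range] at h2
  simp only [levelPairs, mem_filter, mem_univ, true_and]
  refine ⟨h1, ?_⟩
  rw [selD_eq d hi h2.1] at h2
  have hq : q = (⟨i, hi⟩, ⟨(q.2 : ℕ), h2.1⟩) := by
    ext <;> simp [h1]
  rw [hq]; exact h2.2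

/-- The `V`-selected positions of a level inject into the selected pairs of that level.
[folklore] -/
theorem card_selVSet_le (v : ΩV P) {i : ℕ} (hi : i < P.s) :
    (selVSet P v i).card ≤ ((levelPairs P ⟨i, hi⟩).filter fun q => (v q).1 = true).card := by
  have ht : ∀ j ∈ selVSet P v i, j < P.t := fun j hj => by
    simp only [selVSet, mem_filter, mem_range] at hj; exact hj.1
  by_cases ht0 : P.t = 0
  · have : selVSet P v i = ∅ := by
      ext j; simp only [selVSet, mem_filter, mem_range, Finset.notMem_empty, iff_false]; omega
    rw [this]; simp
  refine (le_card_slice hi (Nat.pos_of_ne_zero ht0) ht).trans (Finset.card_le_card fun q hq => ?_)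
  rw [mem_slice] at hq
  obtain ⟨h1, h2⟩ := hq
  simp only [selVSet, mem_filter, mem_range] at h2
  simp only [levelPairs, mem_filter, mem_univ, true_and]
  refine ⟨h1, ?_⟩
  rw [selV_eq v hi h2.1] at h2
  have hq : q = (⟨i, hi⟩, ⟨(q.2 : ℕ), h2.1⟩) := by
    ext <;> simp [h1]
  rw [hq]; exact h2.2

/-- The `I`-selected positions inject into the selected positions. [folklore] -/
theorem card_selISet_le (e : ΩI P) :
    (selISet P e).card ≤ ((univ : Finset (Fin P.t)).filter fun j => (e j).1 = true).card := by
  have ht : ∀ j ∈ selISet P e, j < P.t := fun j hj => by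
    simp only [selISet, mem_filter, mem_range] at hj; exact hj.1
  by_cases ht0 : P.t = 0
  · have : selISet P e = ∅ := by
      ext j; simp only [selISet, mem_filter, mem_range, Finset.notMem_empty, iff_false]; omega
    rw [this]; simp
  refine (le_card_posSet (Nat.pos_of_ne_zero ht0) ht).trans (Finset.card_le_card fun j hj => ?_)
  rw [mem_posSet] at hj
  simp only [selISet, mem_filter, mem_range] at hj
  simp only [mem_filter, mem_univ, true_and]
  rw [selI_eq e hj.1] at hj
  exact hj.2

/-- The `RL`-selected positions of a level inject into the positions whose selection bit is
set. [folklore] -/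
theorem card_selSet_le (g : ΩRL P) {i : ℕ} (hi : i < P.s) :
    (selSet P g i).card ≤ ((univ : Finset (Fin P.t)).filter fun j => (g ⟨i, hi⟩ j).1 = true).card := by
  have ht : ∀ j ∈ selSet P g i, j < P.t := fun j hj => by
    simp only [selSet, mem_filter, mem_range] at hj; exact hj.1
  by_cases ht0 : P.t = 0
  · have : selSet P g i = ∅ := by
      ext j; simp only [selSet, mem_filter, mem_range, Finset.notMem_empty, iff_false]; omega
    rw [this]; simp
  refine (le_card_posSet (Nat.pos_of_ne_zero ht0) ht).trans (Finset.card_le_card fun j hj => ?_)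
  rw [mem_posSet] at hj
  simp only [selSet, mem_filter, mem_range] at hj
  simp only [mem_filter, mem_univ, true_and]
  have h := hj.2
  unfold selRL at h
  split_ifs at h with hc
  exact h

/-- The Chernoff estimate in the form used below. [folklore] -/
theorem chernoff_est {K₀ k t' : ℕ} (hk : K₀ < k) (ht' : t' ≤ P.t) :
    (1 / 2 : ℝ) ^ k * Real.exp (π.p * t') ≤ (1 / 2) ^ (K₀ + 1) * Real.exp (π.p * P.t) := by
  have h1 : (1 / 2 : ℝ) ^ k ≤ (1 / 2) ^ (K₀ + 1) :=
    pow_le_pow_of_le_one (by norm_num) (by norm_num) hk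
  have h2 : Real.exp (π.p * t') ≤ Real.exp (π.p * P.t) :=
    Real.exp_le_exp.2 (mul_le_mul_of_nonneg_left (by exact_mod_cast ht') π.p_nonneg)
  exact mul_le_mul h1 h2 (Real.exp_pos _).le (by positivity)

/-- **[Garlík 2019, Lemma 10 (i)]**: more than `K₀` `D`-selections on a level happen with
probability at most `2^{-(K₀+1)} e^{pt}`. [cite: Garlik2019, Lemma 10 (i)] -/
theorem pr_countD (K₀ : ℕ) {i : ℕ} (hi : i < P.s) :
    π.dist.pr (fun ω => K₀ < (selDSet P ω.1.1.1 i).card) ≤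
      (1 / 2) ^ (K₀ + 1) * Real.exp (π.p * P.t) := by
  apply pr_dist_le_D
  intro v e g
  -- reduce to the selected pairs of the level and apply the Chernoff bound
  have key := FinProb.pr_card_le_half_pow (fun _ : Fin P.s × Fin P.t => π.μD) (levelPairs P ⟨i, hi⟩)
    (fun _ x => x.1) π.p_nonneg (fun q _ => (π.pr_μD_fst).le) (K₀ + 1)
  refine le_trans (FinProb.pr_mono _ fun d hd => ?_) (key.trans (chernoff_est π (Nat.lt_succ_self _)
    (card_levelPairs_le ⟨i, hi⟩)))
  exact Nat.succ_le_of_lt (lt_of_lt_of_le hd (card_selDSet_le d hi))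

/-- **[Garlík 2019, Lemma 10 (ii)], the `V` part**: more than `K₀` `V`-selections on a level
happen with probability at most `2^{-(K₀+1)} e^{pt}`. [cite: Garlik2019, Lemma 10 (ii)] -/
theorem pr_countV (K₀ : ℕ) {i : ℕ} (hi : i < P.s) :
    π.dist.pr (fun ω => K₀ < (selVSet P ω.1.1.2 i).card) ≤
      (1 / 2) ^ (K₀ + 1) * Real.exp (π.p * P.t) := by
  apply pr_dist_le_V
  intro d e g
  have key := FinProb.pr_card_le_half_pow (fun _ : Fin P.s × Fin P.t => π.μV) (levelPairs P ⟨i, hi⟩)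
    (fun _ x => x.1) π.p_nonneg (fun q _ => (π.pr_μV_fst).le) (K₀ + 1)
  refine le_trans (FinProb.pr_mono _ fun v hv => ?_) (key.trans (chernoff_est π (Nat.lt_succ_self _)
    (card_levelPairs_le ⟨i, hi⟩)))
  exact Nat.succ_le_of_lt (lt_of_lt_of_le hv (card_selVSet_le v hi))

/-- **[Garlík 2019, Lemma 10 (iii)]**: more than `K₀` `I`-selections happen with probability
at most `2^{-(K₀+1)} e^{pt}`. [cite: Garlik2019, Lemma 10 (iii)] -/
theorem pr_countI (K₀ : ℕ) :
    π.dist.pr (fun ω => K₀ < (selISet P ω.1.2).card) ≤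
      (1 / 2) ^ (K₀ + 1) * Real.exp (π.p * P.t) := by
  apply pr_dist_le_I
  intro d v g
  have key := FinProb.pr_card_le_half_pow (fun _ : Fin P.t => π.μI) univ
    (fun _ x => x.1) π.p_nonneg (fun q _ => (π.pr_μI_fst).le) (K₀ + 1)
  refine le_trans (FinProb.pr_mono _ fun e he => ?_) (key.trans (chernoff_est π (Nat.lt_succ_self _)
    (by simp)))
  exact Nat.succ_le_of_lt (lt_of_lt_of_le he (card_selISet_le e))

/-- `selSet` of a level only depends on that level. [folklore] -/
theorem selSet_update (g : ΩRL P) {i : ℕ} (hi : i < P.s) (lv : Fin P.t → Bool × (Fin P.t × Fin P.t)) :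
    (selSet P (Function.update g ⟨i, hi⟩ lv) i).card ≤
      ((univ : Finset (Fin P.t)).filter fun j => (lv j).1 = true).card := by
  refine (card_selSet_le _ hi).trans (le_of_eq ?_)
  congr 1
  ext j
  simp

/-- **[Garlík 2019, Lemma 10 (ii)], the `RL` part**: more than `K₀` `RL`-selections on a
level happen with probability at most `2^{-(K₀+1)} e^{pt}`. [cite: Garlik2019, Lemma 10 (ii)] -/
theorem pr_countRL (K₀ : ℕ) {i : ℕ} (hi : i < P.s) :
    π.dist.pr (fun ω => K₀ < (selSet P ω.2 i).card) ≤
      (1 / 2) ^ (K₀ + 1) * Real.exp (π.p * P.t) := by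
  apply pr_dist_le_RL
  intro x
  apply pr_distRL_le_level π ⟨i, hi⟩
  intro g
  have key := FinProb.pr_card_le_half_pow (fun _ : Fin P.t => π.μβ) univ
    (fun _ x => x.1) π.p_nonneg (fun q _ => (π.pr_μβ_fst).le) (K₀ + 1)
  refine le_trans (FinProb.pr_mono _ fun lv hlv => ?_) (key.trans (chernoff_est π (Nat.lt_succ_self _)
    (by simp)))
  exact Nat.succ_le_of_lt (lt_of_lt_of_le hlv (selSet_update g hi lv))

end Counts

/-! ### Width events for `D`, `V`, `I` and the column events (Lemma 14 (i)–(iii), (vi), (vii)) -/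

section Width

variable {P : Params} {Fc : ℕ → Finset (ℕ × Bool)} (π : ProbParams P) {K₀ : ℕ}

/-- Product bound: coordinatewise events of probability `≤ q ∈ [0,1]` on at least `N`
coordinates of `S` hold simultaneously with probability `≤ q ^ N`. [folklore] -/
theorem pr_pi_forall_le_pow {ι : Type*} [Fintype ι] [DecidableEq ι] {κ : Type*} [Fintype κ]
    (μ : ι → FinProb κ) (S : Finset ι) (A : ι → κ → Prop) {q : ℝ} (hq0 : 0 ≤ q) (hq1 : q ≤ 1)
    (hA : ∀ i ∈ S, (μ i).pr (A i) ≤ q) {N : ℕ} (hN : N ≤ S.card) :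
    (FinProb.pi μ).pr (fun f => ∀ i ∈ S, A i (f i)) ≤ q ^ N := by
  rw [FinProb.pr_pi_forall]
  exact (FinProb.prod_le_pow_of_le S (fun i _ => (μ i).pr_nonneg _) hA).trans
    (pow_le_pow_of_le_one hq0 hq1 hN)

/-- The positions `j` with `(i,j)` the last pair: at most one. [folklore] -/
def lastSet (P : Params) (i : ℕ) : Finset ℕ :=
  (Finset.range P.t).filter fun j => IsLast P i j

/-- At most one position of a level is the last pair. [folklore] -/
theorem card_lastSet_le (i : ℕ) : (lastSet P i).card ≤ 1 := by
  refine Finset.card_le_one.2 fun a ha b hb => ?_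
  simp only [lastSet, mem_filter, IsLast] at ha hb
  omega

/-- Lower bound for the size of a difference. [folklore] -/
theorem le_card_sdiff_of_le {M X : Finset ℕ} {W c : ℕ} (hM : W < M.card) (hX : X.card ≤ c) :
    W + 1 - c ≤ (M \ X).card := by
  have h1 : M.card - X.card ≤ (M \ X).card := by
    have := Finset.le_card_sdiff X M
    omega
  omega

/-! #### `D` -/

/-- `D`-mention via a single witness triple. [folklore] -/
theorem dmen_iff {E : Finset (Literal ℕ)} {i j : ℕ} : DMen P E i j ↔ i < P.s ∧ j < P.t ∧
    ∃ w : ℕ × Bool × Bool, w.1 < P.n ∧ ((LRefVar.D i j w.1 w.2.1).code, w.2.2) ∈ E := by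
  constructor
  · rintro ⟨hi, hj, ℓ, hℓ, b, c, h⟩; exact ⟨hi, hj, (ℓ, b, c), hℓ, h⟩
  · rintro ⟨hi, hj, w, hw, h⟩; exact ⟨hi, hj, w.1, hw, w.2.1, w.2.2, h⟩

open Classical in
/-- A witness literal for a `D`-mentioned pair (junk if not mentioned). [folklore] -/
noncomputable def witD (P : Params) (E : Finset (Literal ℕ)) (i j : ℕ) : ℕ × Bool × Bool :=
  if h : DMen P E i j then Classical.choose (dmen_iff.1 h).2.2 else (0, false, false)

/-- Specification of the witness. [folklore] -/
theorem witD_spec {E : Finset (Literal ℕ)} {i j : ℕ} (h : DMen P E i j) :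
    (witD P E i j).1 < P.n ∧
      ((LRefVar.D i j (witD P E i j).1 (witD P E i j).2.1).code, (witD P E i j).2.2) ∈ E := by
  classical
  unfold witD
  rw [dif_pos h]
  exact Classical.choose_spec (dmen_iff.1 h).2.2

/-- The sign that makes the witness literal true. [folklore] -/
def witSign (w : ℕ × Bool × Bool) : Bool := if w.2.2 then w.2.1 else !w.2.1

/-- The coordinate event "the `D`-data of the pair does not satisfy the witness literal".
[cite: Garlik2019, Lemma 14 (proof of (i))] -/
def AD (P : Params) (E : Finset (Literal ℕ)) (i : ℕ) (q : Fin P.s × Fin P.t)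
    (x : Bool × (Fin P.n → Bool)) : Prop :=
  ¬ (x.1 = true ∧ ∃ h : (witD P E i q.2).1 < P.n, x.2 ⟨(witD P E i q.2).1, h⟩ = witSign (witD P E i q.2))

/-- The coordinate event fails with probability `p/2` at a mentioned pair.
[cite: Garlik2019, Lemma 14 (proof of (i): "satisfied by ρ with probability at least p/2")] -/
theorem pr_AD {E : Finset (Literal ℕ)} {i : ℕ} (q : Fin P.s × Fin P.t) (h : DMen P E i q.2) :
    π.μD.pr (AD P E i q) = 1 - π.p / 2 := by
  obtain ⟨hℓ, -⟩ := witD_spec h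
  unfold AD
  rw [FinProb.pr_not, ← π.pr_μD ⟨(witD P E i q.2).1, hℓ⟩ (witSign (witD P E i q.2))]
  congr 1
  refine π.μD.pr_congr fun x => ?_
  simp only [hℓ, exists_true_left]

/-- **[Garlík 2019, Lemma 14 (i)], per level.** The probability that `E` is not satisfied by
`ρ(ω)` although more than `W` pairs of level `i` are `D`-mentioned in `E` (and, on level `0`,
at most `K₀` positions are `I`-selected) is at most `(1 - p/2)^{W - 4K₀}`.
[cite: Garlik2019, Lemma 14 (i)] -/
theorem pr_badD (hP : CoreHyp P Fc) (W : ℕ) (E : Finset (Literal ℕ)) {i : ℕ} (hi : i < P.s) :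
    π.dist.pr (fun ω => ¬ SatBy P (rho P Fc K₀ ω) E ∧ W < (menD P E i).card ∧
        (i = 0 → (selISet P ω.1.2).card ≤ K₀)) ≤ (1 - π.p / 2) ^ (W - 4 * K₀) := by
  classical
  have hp2 : 0 ≤ 1 - π.p / 2 := by linarith [π.p_le_one]
  have hp2' : 1 - π.p / 2 ≤ 1 := by linarith [π.p_nonneg]
  apply pr_dist_le_D
  intro v e g
  -- the free mentioned positions
  set X : Finset ℕ := Kp P K₀ g i ∪ B P K₀ g i ∪ lastSet P i ∪ (if i = 0 then selISet P e else ∅)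
    with hX
  set M' : Finset ℕ := menD P E i \ X with hM'
  by_cases hW : W < (menD P E i).card
  swap
  · refine le_trans (FinProb.pr_mono _ (B := fun _ => False) fun d hd => hW hd.2.1) ?_
    refine le_trans ?_ (pow_nonneg hp2 _)
    rw [FinProb.pr_eq_ex]; simp [FinProb.ex_const]
  by_cases hIcnt : i = 0 → (selISet P e).card ≤ K₀
  swap
  · refine le_trans (FinProb.pr_mono _ (B := fun _ => False) fun d hd => hIcnt hd.2.2) ?_
    refine le_trans ?_ (pow_nonneg hp2 _)
    rw [FinProb.pr_eq_ex]; simp [FinProb.ex_const]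
  have hXc : X.card ≤ 4 * K₀ + 1 := by
    rw [hX]
    refine (Finset.card_union_le _ _).trans ?_
    have h4 : (if i = 0 then selISet P e else ∅).card ≤ K₀ := by
      split_ifs with h0
      · exact hIcnt h0
      · simp
    refine (Nat.add_le_add (Finset.card_union_le _ _) h4).trans ?_
    refine (Nat.add_le_add_right (Nat.add_le_add (Finset.card_union_le _ _) (card_lastSet_le i)) _).trans ?_
    have := card_Kp_le K₀ g i; have := card_B_le K₀ g i
    omega
  have hM'c : W - 4 * K₀ ≤ M'.card := by
    have := le_card_sdiff_of_le hW hXc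
    rw [hM']; omega
  have hM't : ∀ j ∈ M', j < P.t := fun j hj => by
    simp only [hM', mem_sdiff, menD, mem_filter, mem_range] at hj; exact hj.1.1
  have ht : 0 < P.t := by have := hP.n_lt_s; have := hP.s_le_t; omega
  -- containment in the product event
  refine le_trans (FinProb.pr_mono _ (B := fun d => ∀ q ∈ slice P hi M', AD P E i q (d q)) ?_) ?_
  · rintro d ⟨hns, -, -⟩ q hq ⟨hsel, hℓ, hsign⟩
    rw [mem_slice] at hq
    obtain ⟨hq1, hjM⟩ := hq
    set j : ℕ := (q.2 : ℕ) with hjdef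
    have hjt : j < P.t := q.2.is_lt
    simp only [hM', hX, mem_sdiff, mem_union, not_or, menD, mem_filter, mem_range] at hjM
    obtain ⟨⟨-, hmen⟩, ⟨⟨hK, hB⟩, hlast⟩, hIsel⟩ := hjM
    have hq' : q = (⟨i, hi⟩, ⟨j, hjt⟩) := by ext <;> simp [hq1, hjdef]
    -- the clause of `(i, j)` under `ρ`
    have hselD : selD P d i j = true := by rw [selD_eq d hi hjt, ← hq']; exact hsel
    have hnl : ¬ IsLast P i j := by
      intro hl; apply hlast; simp only [lastSet, mem_filter, mem_range]; exact ⟨hjt, hl⟩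
    have hsel' : selD' P (((d, v), e), g) i j := by
      refine ⟨hselD, hnl, fun h0 => ?_⟩
      subst h0
      simp only [if_true, selISet, mem_filter, mem_range, not_and] at hIsel
      simpa using hIsel hjt
    have hD : (rho P Fc K₀ (((d, v), e), g)).D (i, j) = some (clauseOf P (signs P d i j)) := by
      rw [rho_D]
      simp only [hi, hjt, and_self, not_true, if_false]
      rw [if_neg (fun h => hK h.2), if_neg hB, if_pos hsel']
    -- the witness literal is satisfied
    obtain ⟨hwℓ, hwE⟩ := witD_spec hmen
    apply hns
    refine ⟨_, _, hwE, ?_⟩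
    rw [PA.eval_D hD hi hjt hwℓ]
    simp only [Option.some.injEq]
    have hmem : ((witD P E i j).1, (witD P E i j).2.1) ∈ clauseOf P (signs P d i j) ↔
        witSign (witD P E i j) = (witD P E i j).2.1 := by
      rw [mem_clauseOf_iff P hwℓ, signs_eq d hi hjt hwℓ, ← hq', hsign]
    rw [show decide (((witD P E i j).1, (witD P E i j).2.1) ∈ clauseOf P (signs P d i j)) =
        decide (witSign (witD P E i j) = (witD P E i j).2.1) from decide_eq_decide.2 hmem]
    unfold witSign
    cases (witD P E i j).2.2 <;> cases (witD P E i j).2.1 <;> simp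
  · refine pr_pi_forall_le_pow (fun _ => π.μD) (slice P hi M') (AD P E i) hp2 hp2' ?_
      (hM'c.trans (le_card_slice hi ht hM't))
    intro q hq
    rw [mem_slice] at hq
    have hmen : DMen P E i q.2 := by
      have := hq.2
      simp only [hM', mem_sdiff, menD, mem_filter, mem_range] at this
      exact this.1.2
    rw [pr_AD π q hmen]


/-! #### Sets of values as subsets of `Fin N` -/

/-- A set of naturals as a subset of `Fin N`. [folklore] -/
def finFilter (N : ℕ) (M : Finset ℕ) : Finset (Fin N) :=
  univ.filter fun x => (x : ℕ) ∈ M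

/-- Membership in `finFilter`. [folklore] -/
theorem mem_finFilter {N : ℕ} {M : Finset ℕ} {x : Fin N} : x ∈ finFilter N M ↔ (x : ℕ) ∈ M := by
  simp [finFilter]

/-- `finFilter N M` is as large as `M ⊆ [0, N)`. [folklore] -/
theorem le_card_finFilter {N : ℕ} {M : Finset ℕ} (hM : ∀ k ∈ M, k < N) :
    M.card ≤ (finFilter N M).card := by
  rcases M.eq_empty_or_nonempty with rfl | ⟨k₀, hk₀⟩
  · simp
  have hN : 0 < N := by have := hM k₀ hk₀; omega
  refine Finset.card_le_card_of_injOn (fun k => (⟨k % N, Nat.mod_lt _ hN⟩ : Fin N)) ?_ ?_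
  · intro k hk
    have hk' : k ∈ M := hk
    simp only [coe_filter, finFilter, Set.mem_setOf_eq, mem_univ, true_and]
    rw [Nat.mod_eq_of_lt (hM k hk')]
    exact hk'
  · intro k hk k' hk' h
    simp only [Fin.mk.injEq] at h
    rwa [Nat.mod_eq_of_lt (hM k hk), Nat.mod_eq_of_lt (hM k' hk')] at h

/-! #### `V` -/

/-- "Setting `V(i,j,·) := k` satisfies a literal of `E`". [cite: Garlik2019, Lemma 14 (proof
of (iii))] -/
def VSat (P : Params) (E : Finset (Literal ℕ)) (i j k : ℕ) : Prop :=
  ∃ ℓ' < P.n, ∃ c : Bool, ((LRefVar.V i j ℓ').code, c) ∈ E ∧ decide (k = ℓ') = c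

open Classical in
/-- The good values for `V(i,j,·)`. [cite: Garlik2019, Lemma 14 (proof of (iii))] -/
noncomputable def GV (P : Params) (E : Finset (Literal ℕ)) (i j : ℕ) : Finset (Fin P.n) :=
  univ.filter fun x => VSat P E i j x

/-- At least half of the values are good for a `V`-important pair (`n ≥ 2`).
[cite: Garlik2019, Lemma 14 (proof of (iii): "probability at least min{(n-1)/n, 1/2}")] -/
theorem card_GV (hn2 : 2 ≤ P.n) {E : Finset (Literal ℕ)} {i j : ℕ} (h : VImp P E i j) :
    P.n ≤ 2 * (GV P E i j).card := by
  classical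
  rcases h.2.2.2 with ⟨ℓ₀, hℓ₀, hneg⟩ | hpos
  · have hsub : univ.erase (⟨ℓ₀, hℓ₀⟩ : Fin P.n) ⊆ GV P E i j := by
      intro x hx
      rw [mem_erase] at hx
      simp only [GV, mem_filter, mem_univ, true_and]
      refine ⟨ℓ₀, hℓ₀, false, hneg, ?_⟩
      have : (x : ℕ) ≠ ℓ₀ := fun he => hx.1 (Fin.ext he)
      simp [this]
    have := Finset.card_le_card hsub
    rw [Finset.card_erase_of_mem (mem_univ _), card_univ, Fintype.card_fin] at this
    omega
  · set Pos := (Finset.range P.n).filter fun ℓ' => ((LRefVar.V i j ℓ').code, true) ∈ E with hPos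
    have hcnt : posCnt E (fun ℓ => .V i j ℓ) P.n = Pos.card := rfl
    have hsub : finFilter P.n Pos ⊆ GV P E i j := by
      intro x hx
      rw [mem_finFilter] at hx
      simp only [hPos, mem_filter, mem_range] at hx
      simp only [GV, mem_filter, mem_univ, true_and]
      exact ⟨x, x.is_lt, true, hx.2, by simp⟩
    have h1 := Finset.card_le_card hsub
    have h2 := le_card_finFilter (N := P.n) (M := Pos) fun k hk => by
      simp only [hPos, mem_filter, mem_range] at hk; exact hk.1
    omega

/-- The coordinate event "the `V`-data of the pair does not satisfy `E`".
[cite: Garlik2019, Lemma 14 (proof of (iii))] -/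
def AV (P : Params) (E : Finset (Literal ℕ)) (i : ℕ) (q : Fin P.s × Fin P.t) (x : Bool × Fin P.n) : Prop :=
  ¬ (x.1 = true ∧ x.2 ∈ GV P E i q.2)

/-- The coordinate event has probability `≤ 1 - p/2` at a `V`-important pair.
[cite: Garlik2019, Lemma 14 (proof of (iii))] -/
theorem pr_AV (hn2 : 2 ≤ P.n) {E : Finset (Literal ℕ)} {i : ℕ} (q : Fin P.s × Fin P.t)
    (h : VImp P E i q.2) : π.μV.pr (AV P E i q) ≤ 1 - π.p / 2 := by
  unfold AV
  rw [FinProb.pr_not]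
  linarith [π.le_pr_μV (GV P E i q.2) (card_GV hn2 h)]

/-- **[Garlík 2019, Lemma 14 (iii)], per level.** The probability that `E` is not satisfied by
`ρ(ω)` although more than `W` pairs of level `i` are `V`-important in `E` is at most
`(1 - p/2)^{W - 4K₀}`. [cite: Garlik2019, Lemma 14 (iii)] -/
theorem pr_badV (hP : CoreHyp P Fc) (hn2 : 2 ≤ P.n) (W : ℕ) (E : Finset (Literal ℕ)) {i : ℕ}
    (hi : i < P.s) :
    π.dist.pr (fun ω => ¬ SatBy P (rho P Fc K₀ ω) E ∧ W < (impV P E i).card) ≤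
      (1 - π.p / 2) ^ (W - 4 * K₀) := by
  classical
  have hp2 : 0 ≤ 1 - π.p / 2 := by linarith [π.p_le_one]
  have hp2' : 1 - π.p / 2 ≤ 1 := by linarith [π.p_nonneg]
  apply pr_dist_le_V
  intro d e g
  set X : Finset ℕ := Kp P K₀ g i ∪ B P K₀ g i ∪ lastSet P i with hX
  set M' : Finset ℕ := impV P E i \ X with hM'
  by_cases hW : W < (impV P E i).card
  swap
  · refine le_trans (FinProb.pr_mono _ (B := fun _ => False) fun v hv => hW hv.2) ?_
    refine le_trans ?_ (pow_nonneg hp2 _)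
    rw [FinProb.pr_eq_ex]; simp [FinProb.ex_const]
  have hXc : X.card ≤ 4 * K₀ + 1 := by
    rw [hX]
    refine (Finset.card_union_le _ _).trans ?_
    refine (Nat.add_le_add (Finset.card_union_le _ _) (card_lastSet_le i)).trans ?_
    have := card_Kp_le K₀ g i; have := card_B_le K₀ g i
    omega
  have hM'c : W - 4 * K₀ ≤ M'.card := by
    have := le_card_sdiff_of_le hW hXc
    rw [hM']; omega
  have hM't : ∀ j ∈ M', j < P.t := fun j hj => by
    simp only [hM', mem_sdiff, impV, mem_filter, mem_range] at hj; exact hj.1.1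
  have ht : 0 < P.t := by have := hP.n_lt_s; have := hP.s_le_t; omega
  refine le_trans (FinProb.pr_mono _ (B := fun v => ∀ q ∈ slice P hi M', AV P E i q (v q)) ?_) ?_
  · rintro v ⟨hns, -⟩ q hq ⟨hsel, hG⟩
    rw [mem_slice] at hq
    obtain ⟨hq1, hjM⟩ := hq
    set j : ℕ := (q.2 : ℕ) with hjdef
    have hjt : j < P.t := q.2.is_lt
    simp only [hM', hX, mem_sdiff, mem_union, not_or, impV, mem_filter, mem_range] at hjM
    obtain ⟨⟨-, himp⟩, ⟨hK, hB⟩, hlast⟩ := hjM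
    have h1 : 1 ≤ i := himp.1
    have hq' : q = (⟨i, hi⟩, ⟨j, hjt⟩) := by ext <;> simp [hq1, hjdef]
    have hselV : selV P v i j = true := by rw [selV_eq v hi hjt, ← hq']; exact hsel
    have hnl : ¬ IsLast P i j := by
      intro hl; apply hlast; simp only [lastSet, mem_filter, mem_range]; exact ⟨hjt, hl⟩
    have hV : (rho P Fc K₀ (((d, v), e), g)).V (i, j) = some (valV P v i j) := by
      rw [rho_V]
      simp only [h1, hi, hjt, and_self, not_true, if_false]
      rw [if_neg (not_or.2 ⟨hK, hB⟩), if_pos ⟨hselV, hnl⟩]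
    have hval : valV P v i j = ((v q).2 : ℕ) := by rw [valV_eq v hi hjt, ← hq']
    have hG' : VSat P E i j (valV P v i j) := by
      rw [hval]
      have := hG
      simp only [GV, mem_filter, mem_univ, true_and] at this
      exact this
    obtain ⟨ℓ', hℓ', c, hE, hdec⟩ := hG'
    exact hns ⟨_, _, hE, by rw [PA.eval_V hV h1 hi hjt hℓ', hdec]⟩
  · refine pr_pi_forall_le_pow (fun _ => π.μV) (slice P hi M') (AV P E i) hp2 hp2' ?_
      (hM'c.trans (le_card_slice hi ht hM't))
    intro q hq
    rw [mem_slice] at hq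
    have himp : VImp P E i q.2 := by
      have := hq.2
      simp only [hM', mem_sdiff, impV, mem_filter, mem_range] at this
      exact this.1.2
    exact pr_AV π hn2 q himp

/-! #### `I` -/

/-- "Setting `I(j,·) := m` satisfies a literal of `E`". [cite: Garlik2019, Lemma 14 (proof
of (ii))] -/
def ISat (P : Params) (E : Finset (Literal ℕ)) (j m : ℕ) : Prop :=
  ∃ m' < P.r, ∃ c : Bool, ((LRefVar.I j m').code, c) ∈ E ∧ decide (m = m') = c

open Classical in
/-- The good values for `I(j,·)`. [cite: Garlik2019, Lemma 14 (proof of (ii))] -/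
noncomputable def GI (P : Params) (E : Finset (Literal ℕ)) (j : ℕ) : Finset (Fin P.r) :=
  univ.filter fun x => ISat P E j x

/-- At least half of the values are good for an `I`-important position (`r ≥ 2`).
[cite: Garlik2019, Lemma 14 (proof of (ii): "probability at least min{(r-1)/r, 1/2} = 1/2")] -/
theorem card_GI (hr2 : 2 ≤ P.r) {E : Finset (Literal ℕ)} {j : ℕ} (h : IImp P E j) :
    P.r ≤ 2 * (GI P E j).card := by
  classical
  rcases h.2 with ⟨m₀, hm₀, hneg⟩ | hpos
  · have hsub : univ.erase (⟨m₀, hm₀⟩ : Fin P.r) ⊆ GI P E j := by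
      intro x hx
      rw [mem_erase] at hx
      simp only [GI, mem_filter, mem_univ, true_and]
      refine ⟨m₀, hm₀, false, hneg, ?_⟩
      have : (x : ℕ) ≠ m₀ := fun he => hx.1 (Fin.ext he)
      simp [this]
    have := Finset.card_le_card hsub
    rw [Finset.card_erase_of_mem (mem_univ _), card_univ, Fintype.card_fin] at this
    omega
  · set Pos := (Finset.range P.r).filter fun m' => ((LRefVar.I j m').code, true) ∈ E with hPos
    have hcnt : posCnt E (fun m => .I j m) P.r = Pos.card := rfl
    have hsub : finFilter P.r Pos ⊆ GI P E j := by
      intro x hx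
      rw [mem_finFilter] at hx
      simp only [hPos, mem_filter, mem_range] at hx
      simp only [GI, mem_filter, mem_univ, true_and]
      exact ⟨x, x.is_lt, true, hx.2, by simp⟩
    have h1 := Finset.card_le_card hsub
    have h2 := le_card_finFilter (N := P.r) (M := Pos) fun k hk => by
      simp only [hPos, mem_filter, mem_range] at hk; exact hk.1
    omega

/-- The coordinate event "the `I`-data of the position does not satisfy `E`".
[cite: Garlik2019, Lemma 14 (proof of (ii))] -/
def AI (P : Params) (E : Finset (Literal ℕ)) (j : Fin P.t) (x : Bool × Fin P.r) : Prop :=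
  ¬ (x.1 = true ∧ x.2 ∈ GI P E j)

/-- The coordinate event has probability `≤ 1 - p/2` at an `I`-important position.
[cite: Garlik2019, Lemma 14 (proof of (ii))] -/
theorem pr_AI (hr2 : 2 ≤ P.r) {E : Finset (Literal ℕ)} (j : Fin P.t) (h : IImp P E j) :
    π.μI.pr (AI P E j) ≤ 1 - π.p / 2 := by
  unfold AI
  rw [FinProb.pr_not]
  linarith [π.le_pr_μI (GI P E j) (card_GI hr2 h)]

/-- **[Garlík 2019, Lemma 14 (ii)].** The probability that `E` is not satisfied by `ρ(ω)`
although more than `W` positions are `I`-important in `E` is at most `(1 - p/2)^{W - 2K₀}`.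
[cite: Garlik2019, Lemma 14 (ii)] -/
theorem pr_badI (hP : CoreHyp P Fc) (hr2 : 2 ≤ P.r) (W : ℕ) (E : Finset (Literal ℕ)) :
    π.dist.pr (fun ω => ¬ SatBy P (rho P Fc K₀ ω) E ∧ W < (impI P E).card) ≤
      (1 - π.p / 2) ^ (W - 2 * K₀) := by
  classical
  have hp2 : 0 ≤ 1 - π.p / 2 := by linarith [π.p_le_one]
  have hp2' : 1 - π.p / 2 ≤ 1 := by linarith [π.p_nonneg]
  apply pr_dist_le_I
  intro d v g
  set M' : Finset ℕ := impI P E \ B P K₀ g 0 with hM'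
  by_cases hW : W < (impI P E).card
  swap
  · refine le_trans (FinProb.pr_mono _ (B := fun _ => False) fun e he => hW he.2) ?_
    refine le_trans ?_ (pow_nonneg hp2 _)
    rw [FinProb.pr_eq_ex]; simp [FinProb.ex_const]
  have hM'c : W - 2 * K₀ ≤ M'.card := by
    have := le_card_sdiff_of_le hW (card_B_le K₀ g 0)
    rw [hM']; omega
  have hM't : ∀ j ∈ M', j < P.t := fun j hj => by
    simp only [hM', mem_sdiff, impI, mem_filter, mem_range] at hj; exact hj.1.1
  have ht : 0 < P.t := by have := hP.n_lt_s; have := hP.s_le_t; omega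
  refine le_trans (FinProb.pr_mono _ (B := fun e => ∀ j ∈ posSet P M', AI P E j (e j)) ?_) ?_
  · rintro e ⟨hns, -⟩ j hj ⟨hsel, hG⟩
    rw [mem_posSet] at hj
    simp only [hM', mem_sdiff, impI, mem_filter, mem_range] at hj
    obtain ⟨⟨hjt, himp⟩, hB⟩ := hj
    have hselI : selI P e j = true := by rw [selI_eq e hjt]; exact hsel
    have hI : (rho P Fc K₀ (((d, v), e), g)).I j = some (valI P e j) := by
      rw [rho_I]
      simp only [hjt, not_true, if_false]
      rw [if_neg hB, if_pos hselI]
    have hval : valI P e j = ((e j).2 : ℕ) := by rw [valI_eq e hjt]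
    have hG' : ISat P E j (valI P e j) := by
      rw [hval]
      have := hG
      simp only [GI, mem_filter, mem_univ, true_and] at this
      exact this
    obtain ⟨m', hm', c, hE, hdec⟩ := hG'
    exact hns ⟨_, _, hE, by rw [PA.eval_I hI hjt hm', hdec]⟩
  · refine pr_pi_forall_le_pow (fun _ => π.μI) (posSet P M') (AI P E) hp2 hp2' ?_
      (hM'c.trans (le_card_posSet ht hM't))
    intro j hj
    rw [mem_posSet] at hj
    have himp : IImp P E j := by
      simp only [hM', mem_sdiff, impI, mem_filter, mem_range] at hj
      exact hj.1.2
    exact pr_AI π hr2 j himp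

/-! #### Columns -/

/-- The positions `j` with the positive literal `I(j,m)` in `E`. [cite: Garlik2019, Lemma 14
(vi)] -/
def icol (P : Params) (E : Finset (Literal ℕ)) (m : ℕ) : Finset ℕ :=
  (Finset.range P.t).filter fun j => ((LRefVar.I j m).code, true) ∈ E

/-- The positions `j` with the positive literal `V(i,j,ℓ)` in `E`. [cite: Garlik2019,
Lemma 14 (vii)] -/
def vcol (P : Params) (E : Finset (Literal ℕ)) (i ℓ : ℕ) : Finset ℕ :=
  (Finset.range P.t).filter fun j => ((LRefVar.V i j ℓ).code, true) ∈ E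

/-- **[Garlík 2019, Lemma 14 (vi)].** For `m < r`, the probability that `E` is not satisfied
by `ρ(ω)` although more than `T` positive literals `I(j,m)` are in `E` is at most
`(1 - p/r)^{T - 2K₀}`. [cite: Garlik2019, Lemma 14 (vi)] -/
theorem pr_badIcol (hP : CoreHyp P Fc) (T : ℕ) (E : Finset (Literal ℕ)) {m : ℕ} (hm : m < P.r) :
    π.dist.pr (fun ω => ¬ SatBy P (rho P Fc K₀ ω) E ∧ T < (icol P E m).card) ≤
      (1 - π.p / P.r) ^ (T - 2 * K₀) := by
  classical
  have hrpos : (0 : ℝ) < P.r := by exact_mod_cast hP.one_le_r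
  have hpr : π.p / P.r ≤ 1 := by
    rw [div_le_one hrpos]
    exact π.p_le_one.trans (by exact_mod_cast hP.one_le_r)
  have hp2 : 0 ≤ 1 - π.p / P.r := by linarith
  have hp2' : 1 - π.p / P.r ≤ 1 := by
    have : 0 ≤ π.p / P.r := div_nonneg π.p_nonneg hrpos.le
    linarith
  apply pr_dist_le_I
  intro d v g
  set M' : Finset ℕ := icol P E m \ B P K₀ g 0 with hM'
  by_cases hW : T < (icol P E m).card
  swap
  · refine le_trans (FinProb.pr_mono _ (B := fun _ => False) fun e he => hW he.2) ?_
    refine le_trans ?_ (pow_nonneg hp2 _)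
    rw [FinProb.pr_eq_ex]; simp [FinProb.ex_const]
  have hM'c : T - 2 * K₀ ≤ M'.card := by
    have := le_card_sdiff_of_le hW (card_B_le K₀ g 0)
    rw [hM']; omega
  have hM't : ∀ j ∈ M', j < P.t := fun j hj => by
    simp only [hM', mem_sdiff, icol, mem_filter, mem_range] at hj; exact hj.1.1
  have ht : 0 < P.t := by have := hP.n_lt_s; have := hP.s_le_t; omega
  refine le_trans (FinProb.pr_mono _
    (B := fun e => ∀ j ∈ posSet P M', ¬ ((e j).1 = true ∧ (e j).2 = ⟨m, hm⟩)) ?_) ?_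
  · rintro e ⟨hns, -⟩ j hj ⟨hsel, hval⟩
    rw [mem_posSet] at hj
    simp only [hM', mem_sdiff, icol, mem_filter, mem_range] at hj
    obtain ⟨⟨hjt, hE⟩, hB⟩ := hj
    have hselI : selI P e j = true := by rw [selI_eq e hjt]; exact hsel
    have hI : (rho P Fc K₀ (((d, v), e), g)).I j = some m := by
      rw [rho_I]
      simp only [hjt, not_true, if_false]
      rw [if_neg hB, if_pos hselI, valI_eq e hjt, hval]
    exact hns ⟨_, _, hE, by rw [PA.eval_I hI hjt hm]; simp⟩
  · refine pr_pi_forall_le_pow (fun _ => π.μI) (posSet P M')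
      (fun (_ : Fin P.t) (x : Bool × Fin P.r) => ¬ (x.1 = true ∧ x.2 = ⟨m, hm⟩)) hp2 hp2' ?_
      (hM'c.trans (le_card_posSet ht hM't))
    intro j _
    rw [FinProb.pr_not, π.pr_μI_eq ⟨m, hm⟩]

/-- **[Garlík 2019, Lemma 14 (vii)].** For `1 ≤ i < s` and `ℓ < n`, the probability that `E`
is not satisfied by `ρ(ω)` although more than `T` positive literals `V(i,j,ℓ)` are in `E` is at
most `(1 - p/n)^{T - 4K₀}`. [cite: Garlik2019, Lemma 14 (vii)] -/
theorem pr_badVcol (hP : CoreHyp P Fc) (T : ℕ) (E : Finset (Literal ℕ)) {i ℓ : ℕ} (h1 : 1 ≤ i)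
    (hi : i < P.s) (hℓ : ℓ < P.n) :
    π.dist.pr (fun ω => ¬ SatBy P (rho P Fc K₀ ω) E ∧ T < (vcol P E i ℓ).card) ≤
      (1 - π.p / P.n) ^ (T - 4 * K₀) := by
  classical
  have hnpos : (0 : ℝ) < P.n := by exact_mod_cast hP.one_le_n
  have hpr : π.p / P.n ≤ 1 := by
    rw [div_le_one hnpos]
    exact π.p_le_one.trans (by exact_mod_cast hP.one_le_n)
  have hp2 : 0 ≤ 1 - π.p / P.n := by linarith
  have hp2' : 1 - π.p / P.n ≤ 1 := by
    have : 0 ≤ π.p / P.n := div_nonneg π.p_nonneg hnpos.le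
    linarith
  apply pr_dist_le_V
  intro d e g
  set X : Finset ℕ := Kp P K₀ g i ∪ B P K₀ g i ∪ lastSet P i with hX
  set M' : Finset ℕ := vcol P E i ℓ \ X with hM'
  by_cases hW : T < (vcol P E i ℓ).card
  swap
  · refine le_trans (FinProb.pr_mono _ (B := fun _ => False) fun v hv => hW hv.2) ?_
    refine le_trans ?_ (pow_nonneg hp2 _)
    rw [FinProb.pr_eq_ex]; simp [FinProb.ex_const]
  have hXc : X.card ≤ 4 * K₀ + 1 := by
    rw [hX]
    refine (Finset.card_union_le _ _).trans ?_
    refine (Nat.add_le_add (Finset.card_union_le _ _) (card_lastSet_le i)).trans ?_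
    have := card_Kp_le K₀ g i; have := card_B_le K₀ g i
    omega
  have hM'c : T - 4 * K₀ ≤ M'.card := by
    have := le_card_sdiff_of_le hW hXc
    rw [hM']; omega
  have hM't : ∀ j ∈ M', j < P.t := fun j hj => by
    simp only [hM', mem_sdiff, vcol, mem_filter, mem_range] at hj; exact hj.1.1
  have ht : 0 < P.t := by have := hP.n_lt_s; have := hP.s_le_t; omega
  refine le_trans (FinProb.pr_mono _
    (B := fun v => ∀ q ∈ slice P hi M', ¬ ((v q).1 = true ∧ (v q).2 = ⟨ℓ, hℓ⟩)) ?_) ?_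
  · rintro v ⟨hns, -⟩ q hq ⟨hsel, hval⟩
    rw [mem_slice] at hq
    obtain ⟨hq1, hjM⟩ := hq
    set j : ℕ := (q.2 : ℕ) with hjdef
    have hjt : j < P.t := q.2.is_lt
    simp only [hM', hX, mem_sdiff, mem_union, not_or, vcol, mem_filter, mem_range] at hjM
    obtain ⟨⟨-, hE⟩, ⟨hK, hB⟩, hlast⟩ := hjM
    have hq' : q = (⟨i, hi⟩, ⟨j, hjt⟩) := by ext <;> simp [hq1, hjdef]
    have hselV : selV P v i j = true := by rw [selV_eq v hi hjt, ← hq']; exact hsel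
    have hnl : ¬ IsLast P i j := by
      intro hl; apply hlast; simp only [lastSet, mem_filter, mem_range]; exact ⟨hjt, hl⟩
    have hV : (rho P Fc K₀ (((d, v), e), g)).V (i, j) = some ℓ := by
      rw [rho_V]
      simp only [h1, hi, hjt, and_self, not_true, if_false]
      rw [if_neg (not_or.2 ⟨hK, hB⟩), if_pos ⟨hselV, hnl⟩, valV_eq v hi hjt, ← hq', hval]
    exact hns ⟨_, _, hE, by rw [PA.eval_V hV h1 hi hjt hℓ]; simp⟩
  · refine pr_pi_forall_le_pow (fun _ => π.μV) (slice P hi M')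
      (fun (_ : Fin P.s × Fin P.t) (x : Bool × Fin P.n) => ¬ (x.1 = true ∧ x.2 = ⟨ℓ, hℓ⟩)) hp2 hp2'
      ?_ (hM'c.trans (le_card_slice hi ht hM't))
    intro q _
    rw [FinProb.pr_not, π.pr_μV_eq ⟨ℓ, hℓ⟩]

end Width

/-! ### Width events for `L` and `R` (Lemma 14 (iv), (v)) -/

section Prem

variable {P : Params} {Fc : ℕ → Finset (ℕ × Bool)} (π : ProbParams P) {K₀ : ℕ}

/-! #### Level-locality of the forest -/

/-- The `RL`-accessors of a level only read that level. [folklore] -/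
theorem level_congr {g g' : ΩRL P} {i : ℕ} (h : ∀ hi : i < P.s, g ⟨i, hi⟩ = g' ⟨i, hi⟩) (j : ℕ) :
    selRL P g i j = selRL P g' i j ∧ cL P g i j = cL P g' i j ∧ cR P g i j = cR P g' i j := by
  refine ⟨?_, ?_, ?_⟩
  · unfold selRL; split_ifs with hc
    · rw [h hc.2.1]
    · rfl
  · unfold cL; split_ifs with hc
    · rw [h hc.1]
    · rfl
  · unfold cR; split_ifs with hc
    · rw [h hc.1]
    · rfl

/-- `usedBefore` of a level only reads that level. [folklore] -/
theorem usedBefore_congr {g g' : ΩRL P} {i : ℕ} (h : ∀ hi : i < P.s, g ⟨i, hi⟩ = g' ⟨i, hi⟩) (j : ℕ) :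
    usedBefore P g i j = usedBefore P g' i j := by
  unfold usedBefore
  have hs : ∀ j', selRL P g i j' = selRL P g' i j' := fun j' => (level_congr h j').1
  rw [Finset.filter_congr (fun j' _ => by rw [hs j'])]
  refine Finset.biUnion_congr rfl fun j' _ => ?_
  rw [(level_congr h j').2.1, (level_congr h j').2.2]

/-- `S` of a level only reads that level. [folklore] -/
theorem S_congr (K₀ : ℕ) {g g' : ΩRL P} {i : ℕ} (h : ∀ hi : i < P.s, g ⟨i, hi⟩ = g' ⟨i, hi⟩) :
    S P K₀ g i = S P K₀ g' i := by
  have hs : ∀ j', selRL P g i j' = selRL P g' i j' := fun j' => (level_congr h j').1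
  have hsel : selSet P g i = selSet P g' i := by
    unfold selSet; exact Finset.filter_congr fun j' _ => by rw [hs j']
  have hsurv : ∀ j', Surv P g i j' ↔ Surv P g' i j' := by
    intro j'
    unfold Surv
    rw [hs j', (level_congr h j').2.1, (level_congr h j').2.2, usedBefore_congr h j']
  unfold S
  rw [hsel, Finset.filter_congr fun j' _ => hsurv j']

/-- `B i` only reads level `i + 1`. [folklore] -/
theorem B_congr (K₀ : ℕ) {g g' : ΩRL P} {i : ℕ}
    (h : ∀ hi : i + 1 < P.s, g ⟨i + 1, hi⟩ = g' ⟨i + 1, hi⟩) : B P K₀ g i = B P K₀ g' i := by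
  unfold B
  rw [S_congr K₀ h]
  refine Finset.biUnion_congr rfl fun j' _ => ?_
  rw [(level_congr h j').2.1, (level_congr h j').2.2]

/-- Updating level `i` does not change `B i`. [folklore] -/
theorem B_update_self (K₀ : ℕ) (g : ΩRL P) {i : ℕ} (hi : i < P.s)
    (lv : Fin P.t → Bool × (Fin P.t × Fin P.t)) :
    B P K₀ (Function.update g ⟨i, hi⟩ lv) i = B P K₀ g i :=
  B_congr K₀ fun hi' => by
    rw [Function.update_of_ne]
    exact fun heq => by simp [Fin.ext_iff] at heq

/-- The accessors of an updated level, in range. [folklore] -/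
theorem level_update_eq (g : ΩRL P) {i j : ℕ} (h1 : 1 ≤ i) (hi : i < P.s) (hjt : j < P.t)
    (hnl : ¬ IsLast P i j) (lv : Fin P.t → Bool × (Fin P.t × Fin P.t)) :
    selRL P (Function.update g ⟨i, hi⟩ lv) i j = (lv ⟨j, hjt⟩).1 ∧
      cL P (Function.update g ⟨i, hi⟩ lv) i j = ((lv ⟨j, hjt⟩).2.1 : ℕ) ∧
      cR P (Function.update g ⟨i, hi⟩ lv) i j = ((lv ⟨j, hjt⟩).2.2 : ℕ) := by
  refine ⟨?_, ?_, ?_⟩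
  · unfold selRL; rw [dif_pos ⟨h1, hi, hjt, hnl⟩]; simp
  · unfold cL; rw [dif_pos ⟨hi, hjt⟩]; simp
  · unfold cR; rw [dif_pos ⟨hi, hjt⟩]; simp

/-- Two versions of a level that agree up to position `j` give the same accessors up to `j`.
[folklore] -/
theorem level_update_agree (g : ΩRL P) {i : ℕ} (hi : i < P.s)
    {lv lv' : Fin P.t → Bool × (Fin P.t × Fin P.t)} {j : Fin P.t}
    (hagree : ∀ k : Fin P.t, k ≤ j → lv k = lv' k) {j' : ℕ} (hj' : j' ≤ j) :
    selRL P (Function.update g ⟨i, hi⟩ lv) i j' = selRL P (Function.update g ⟨i, hi⟩ lv') i j' ∧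
      cL P (Function.update g ⟨i, hi⟩ lv) i j' = cL P (Function.update g ⟨i, hi⟩ lv') i j' ∧
      cR P (Function.update g ⟨i, hi⟩ lv) i j' = cR P (Function.update g ⟨i, hi⟩ lv') i j' := by
  have key : ∀ hj't : j' < P.t, lv ⟨j', hj't⟩ = lv' ⟨j', hj't⟩ := fun hj't =>
    hagree ⟨j', hj't⟩ (by rw [Fin.le_def]; exact hj')
  refine ⟨?_, ?_, ?_⟩
  · unfold selRL; split_ifs with hc
    · simp [key hc.2.2.1]
    · rfl
  · unfold cL; split_ifs with hc
    · simp [key hc.2]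
    · rfl
  · unfold cR; split_ifs with hc
    · simp [key hc.2]
    · rfl

/-- The number of selected positions of level `i` before position `j`.
[cite: Garlik2019, Lemma 14 (proof of (iv): |A_{i,j}|)] -/
def countBefore (P : Params) (g : ΩRL P) (i j : ℕ) : ℕ :=
  ((Finset.range j).filter fun j' => selRL P g i j' = true).card

/-- At most two children are used per earlier selected position. [folklore] -/
theorem card_usedBefore_le (g : ΩRL P) (i j : ℕ) :
    (usedBefore P g i j).card ≤ 2 * countBefore P g i j := by
  unfold usedBefore countBefore
  calc (((Finset.range j).filter fun j' => selRL P g i j' = true).biUnion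
          fun j' => ({cL P g i j', cR P g i j'} : Finset ℕ)).card
      ≤ ∑ j' ∈ (Finset.range j).filter (fun j' => selRL P g i j' = true),
          ({cL P g i j', cR P g i j'} : Finset ℕ).card := Finset.card_biUnion_le
    _ ≤ ∑ _j' ∈ (Finset.range j).filter (fun j' => selRL P g i j' = true), 2 :=
        Finset.sum_le_sum fun j' _ => Finset.card_le_two
    _ = _ := by rw [Finset.sum_const, smul_eq_mul, mul_comm]

/-- `countBefore` is at most the level count. [folklore] -/
theorem countBefore_le_card_selSet (g : ΩRL P) (i : ℕ) {j : ℕ} (hj : j ≤ P.t) :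
    countBefore P g i j ≤ (selSet P g i).card := by
  unfold countBefore selSet
  exact Finset.card_le_card (Finset.monotone_filter_left _ (Finset.range_subset_range.2 hj))

/-- `usedBefore` and `countBefore` at `j` agree for two versions of the level that agree
below `j`. [folklore] -/
theorem before_update_agree (g : ΩRL P) {i : ℕ} (hi : i < P.s)
    {lv lv' : Fin P.t → Bool × (Fin P.t × Fin P.t)} {j : Fin P.t}
    (hagree : ∀ k : Fin P.t, k < j → lv k = lv' k) :
    usedBefore P (Function.update g ⟨i, hi⟩ lv) i j = usedBefore P (Function.update g ⟨i, hi⟩ lv') i j ∧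
      countBefore P (Function.update g ⟨i, hi⟩ lv) i j =
        countBefore P (Function.update g ⟨i, hi⟩ lv') i j := by
  have key : ∀ j' < (j : ℕ),
      selRL P (Function.update g ⟨i, hi⟩ lv) i j' = selRL P (Function.update g ⟨i, hi⟩ lv') i j' ∧
      cL P (Function.update g ⟨i, hi⟩ lv) i j' = cL P (Function.update g ⟨i, hi⟩ lv') i j' ∧
      cR P (Function.update g ⟨i, hi⟩ lv) i j' = cR P (Function.update g ⟨i, hi⟩ lv') i j' := by
    intro j' hj'
    have k2 : ∀ hj't : j' < P.t, lv ⟨j', hj't⟩ = lv' ⟨j', hj't⟩ := fun hj't =>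
      hagree ⟨j', hj't⟩ (by rw [Fin.lt_def]; exact hj')
    refine ⟨?_, ?_, ?_⟩
    · unfold selRL; split_ifs with hc
      · simp [k2 hc.2.2.1]
      · rfl
    · unfold cL; split_ifs with hc
      · simp [k2 hc.2]
      · rfl
    · unfold cR; split_ifs with hc
      · simp [k2 hc.2]
      · rfl
  constructor
  · unfold usedBefore
    rw [Finset.filter_congr (fun j' hj' => by rw [(key j' (mem_range.1 hj')).1])]
    refine Finset.biUnion_congr rfl fun j' hj' => ?_
    have hj'r : j' < (j : ℕ) := mem_range.1 (Finset.mem_filter.1 hj').1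
    rw [(key j' hj'r).2.1, (key j' hj'r).2.2]
  · unfold countBefore
    rw [Finset.filter_congr (fun j' hj' => by rw [(key j' (mem_range.1 hj')).1])]

/-! #### The quarter estimate -/

/-- Pairs with first coordinate in `A₁`, second in `A₂`, and distinct coordinates: at least
`|A₁| (|A₂| - 1)` of them (in the form `|A₁| |A₂| ≤ |·| + |A₁|`).
[cite: Garlik2019, Lemma 14 (proof of (iv): "(|T_{i,j} ∖ rng(h_{i,j-1})|)/t")] -/
theorem card_pairs_ge {t : ℕ} (A₁ A₂ : Finset (Fin t)) :
    A₁.card * A₂.card ≤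
      ((A₁ ×ˢ A₂).filter fun c : Fin t × Fin t => c.1 ≠ c.2).card + A₁.card := by
  classical
  have hsub : A₁ ×ˢ A₂ ⊆ ((A₁ ×ˢ A₂).filter fun c : Fin t × Fin t => c.1 ≠ c.2) ∪
      A₁.image fun a => (a, a) := by
    intro c hc
    rw [mem_union, mem_filter, mem_image]
    by_cases h : c.1 = c.2
    · right; exact ⟨c.1, (mem_product.1 hc).1, by ext <;> simp [h]⟩
    · left; exact ⟨hc, h⟩
  calc A₁.card * A₂.card = (A₁ ×ˢ A₂).card := (card_product _ _).symm
    _ ≤ _ := Finset.card_le_card hsub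
    _ ≤ ((A₁ ×ˢ A₂).filter fun c : Fin t × Fin t => c.1 ≠ c.2).card +
          (A₁.image fun a => (a, a)).card := Finset.card_union_le _ _
    _ ≤ _ := Nat.add_le_add_left Finset.card_image_le _

/-- The arithmetic behind the factor `1/4`: if `16K₀ + 16 ≤ t`, `a ≥ t/2 - 2K₀` and
`b ≥ t - 2K₀`, then `ab - min ≥ t²/4` in both forms used. [folklore] -/
theorem quarter_arith {t K₀ a b : ℕ} (hK : 16 * K₀ + 16 ≤ t) (ha : t ≤ 2 * a + 4 * K₀)
    (hb : t ≤ b + 2 * K₀) (hat : a ≤ t) (hbt : b ≤ t) :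
    t * t + 4 * a ≤ 4 * (a * b) ∧ t * t + 4 * b ≤ 4 * (b * a) := by
  constructor <;> nlinarith

/-! #### Satisfaction through a premise -/

/-- "Setting `L(i,j,·) := k` satisfies a literal of `E`". [cite: Garlik2019, Lemma 14 (proof
of (iv): the sets T_{i,j})] -/
def LSat (P : Params) (E : Finset (Literal ℕ)) (i j k : ℕ) : Prop :=
  ∃ k' < P.t, ∃ c : Bool, ((LRefVar.L i j k').code, c) ∈ E ∧ decide (k = k') = c

open Classical in
/-- The set `T_{i,j}` of good `L`-premises. [cite: Garlik2019, Lemma 14 (proof of (iv))] -/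
noncomputable def GL (P : Params) (E : Finset (Literal ℕ)) (i j : ℕ) : Finset (Fin P.t) :=
  univ.filter fun x => LSat P E i j x

/-- `|T_{i,j}| ≥ t/2` at an `L`-important pair (`t ≥ 2`). [cite: Garlik2019, Lemma 14 (proof
of (iv): "We know that |T_{i,j}| ≥ t/2")] -/
theorem card_GL (ht2 : 2 ≤ P.t) {E : Finset (Literal ℕ)} {i j : ℕ} (h : LImp P E i j) :
    P.t ≤ 2 * (GL P E i j).card := by
  classical
  rcases h.2.2.2 with ⟨k₀, hk₀, hneg⟩ | hpos
  · have hsub : univ.erase (⟨k₀, hk₀⟩ : Fin P.t) ⊆ GL P E i j := by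
      intro x hx
      rw [mem_erase] at hx
      simp only [GL, mem_filter, mem_univ, true_and]
      refine ⟨k₀, hk₀, false, hneg, ?_⟩
      have : (x : ℕ) ≠ k₀ := fun he => hx.1 (Fin.ext he)
      simp [this]
    have := Finset.card_le_card hsub
    rw [Finset.card_erase_of_mem (mem_univ _), card_univ, Fintype.card_fin] at this
    omega
  · set Pos := (Finset.range P.t).filter fun k' => ((LRefVar.L i j k').code, true) ∈ E with hPos
    have hcnt : posCnt E (fun k => .L i j k) P.t = Pos.card := rfl
    have hsub : finFilter P.t Pos ⊆ GL P E i j := by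
      intro x hx
      rw [mem_finFilter] at hx
      simp only [hPos, mem_filter, mem_range] at hx
      simp only [GL, mem_filter, mem_univ, true_and]
      exact ⟨x, x.is_lt, true, hx.2, by simp⟩
    have h1 := Finset.card_le_card hsub
    have h2 := le_card_finFilter (N := P.t) (M := Pos) fun k hk => by
      simp only [hPos, mem_filter, mem_range] at hk; exact hk.1
    omega

/-- The success event at position `j` of level `i`: selected, good fresh left child, fresh
distinct right child. [cite: Garlik2019, Lemma 14 (proof of (iv))] -/
def SuccL (P : Params) (E : Finset (Literal ℕ)) (g : ΩRL P) (i j : ℕ) : Prop :=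
  selRL P g i j = true ∧ LSat P E i j (cL P g i j) ∧ cL P g i j ∉ usedBefore P g i j ∧
    cR P g i j ∉ usedBefore P g i j ∧ cL P g i j ≠ cR P g i j

/-- The adapted event at position `j`: few selections before `j`, and no success at `j`.
[cite: Garlik2019, Lemma 14 (proof of (iv), event (b))] -/
def FL (P : Params) (E : Finset (Literal ℕ)) (K₀ : ℕ) (g : ΩRL P) (i j : ℕ) : Prop :=
  countBefore P g i j ≤ K₀ ∧ ¬ SuccL P E g i j

/-- The good proposals at position `j` given the used children: good fresh left child,
fresh distinct right child. [cite: Garlik2019, Lemma 14 (proof of (iv))] -/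
noncomputable def GoodL (P : Params) (E : Finset (Literal ℕ)) (i j : ℕ) (used : Finset ℕ) :
    Finset (Fin P.t × Fin P.t) :=
  by classical exact
  ((GL P E i j \ finFilter P.t used) ×ˢ (univ \ finFilter P.t used)).filter fun c => c.1 ≠ c.2

/-- The good proposals are at least a quarter of all pairs when `|used| ≤ 2K₀`,
`16K₀ + 16 ≤ t` and `(i,j)` is `L`-important. [cite: Garlik2019, Lemma 14 (proof of (iv):
"(t/2 - 4pt)/t = (1-8p)/2 ≥ 1/3", here 1/4)] -/
theorem card_GoodL (hK : 16 * K₀ + 16 ≤ P.t) {E : Finset (Literal ℕ)} {i j : ℕ} (h : LImp P E i j)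
    {used : Finset ℕ} (hu : used.card ≤ 2 * K₀) :
    P.t * P.t ≤ 4 * (GoodL P E i j used).card := by
  classical
  set A₁ := GL P E i j \ finFilter P.t used with hA₁
  set A₂ := (univ : Finset (Fin P.t)) \ finFilter P.t used with hA₂
  have hfin : (finFilter P.t used).card ≤ 2 * K₀ :=
    (Finset.card_le_card_of_injOn (fun x : Fin P.t => (x : ℕ)) (fun x hx => by
      simpa [finFilter] using hx) (fun x _ y _ hxy => Fin.ext hxy)).trans hu
  have hT := card_GL (by omega) h
  have ha : P.t ≤ 2 * A₁.card + 4 * K₀ := by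
    have := Finset.le_card_sdiff (finFilter P.t used) (GL P E i j)
    rw [hA₁]; omega
  have hb : P.t ≤ A₂.card + 2 * K₀ := by
    have := Finset.le_card_sdiff (finFilter P.t used) (univ : Finset (Fin P.t))
    rw [card_univ, Fintype.card_fin] at this
    rw [hA₂]; omega
  have hat : A₁.card ≤ P.t := (card_le_univ _).trans (by simp)
  have hbt : A₂.card ≤ P.t := (card_le_univ _).trans (by simp)
  have hpairs := card_pairs_ge A₁ A₂
  have := (quarter_arith hK ha hb hat hbt).1
  unfold GoodL
  rw [← hA₁, ← hA₂]
  omega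

/-- **The conditional bound**: given the level below `j` (with at most `K₀` selections before
`j`), the adapted event at an `L`-important, in-range position `j` has probability at most
`1 - p/4`. [cite: Garlik2019, Lemma 14 (proof of (iv): "the probability … is at least 1/3")] -/
theorem pr_FL_update (hK : 16 * K₀ + 16 ≤ P.t) {E : Finset (Literal ℕ)} (g₀ : ΩRL P) {i : ℕ}
    (h1 : 1 ≤ i) (hi : i < P.s) (j : Fin P.t) (himp : LImp P E i j) (hnl : ¬ IsLast P i j)
    (lv : Fin P.t → Bool × (Fin P.t × Fin P.t)) :
    π.μβ.pr (fun a => FL P E K₀ (Function.update g₀ ⟨i, hi⟩ (Function.update lv j a)) i j) ≤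
      1 - π.p / 4 := by
  classical
  set g := Function.update g₀ ⟨i, hi⟩ lv with hg
  -- what is seen below `j` does not depend on the value at `j`
  have hbefore : ∀ a, usedBefore P (Function.update g₀ ⟨i, hi⟩ (Function.update lv j a)) i j =
      usedBefore P g i j ∧ countBefore P (Function.update g₀ ⟨i, hi⟩ (Function.update lv j a)) i j =
      countBefore P g i j := fun a =>
    before_update_agree g₀ hi fun k hk => Function.update_of_ne (ne_of_lt hk) _ _
  have hat : ∀ a : Bool × (Fin P.t × Fin P.t),
      selRL P (Function.update g₀ ⟨i, hi⟩ (Function.update lv j a)) i j = a.1 ∧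
      cL P (Function.update g₀ ⟨i, hi⟩ (Function.update lv j a)) i j = (a.2.1 : ℕ) ∧
      cR P (Function.update g₀ ⟨i, hi⟩ (Function.update lv j a)) i j = (a.2.2 : ℕ) := by
    intro a
    have := level_update_eq g₀ h1 hi j.is_lt hnl (Function.update lv j a)
    simpa using this
  by_cases hcnt : countBefore P g i j ≤ K₀
  swap
  · -- the event is empty
    refine le_trans (FinProb.pr_mono _ (B := fun _ => False) fun a ha => hcnt ?_) ?_
    · rw [← (hbefore a).2]; exact ha.1
    · rw [FinProb.pr_eq_ex]
      simp only [if_false]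
      rw [FinProb.ex_const]
      linarith [π.p_le_one]
  · set used := usedBefore P g i j with hused
    have hu : used.card ≤ 2 * K₀ := (card_usedBefore_le g i j).trans (by omega)
    -- the event implies that the proposal is not good
    refine le_trans (FinProb.pr_mono _
      (B := fun a => ¬ (a.1 = true ∧ a.2 ∈ GoodL P E i j used)) fun a ha hgood => ?_) ?_
    · apply ha.2
      obtain ⟨hs, hcl, hcr⟩ := hat a
      refine ⟨hs.trans hgood.1, ?_, ?_, ?_, ?_⟩
      · rw [hcl]
        have := hgood.2
        simp only [GoodL, mem_filter, mem_product, mem_sdiff, GL, mem_univ, true_and] at this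
        exact this.1.1.1
      · rw [hcl, (hbefore a).1]
        have := hgood.2
        simp only [GoodL, mem_filter, mem_product, mem_sdiff, mem_finFilter] at this
        exact this.1.1.2
      · rw [hcr, (hbefore a).1]
        have := hgood.2
        simp only [GoodL, mem_filter, mem_product, mem_sdiff, mem_finFilter] at this
        exact this.1.2.2
      · rw [hcl, hcr]
        have := hgood.2
        simp only [GoodL, mem_filter] at this
        exact fun he => this.2 (Fin.ext he)
    · rw [FinProb.pr_not]
      linarith [π.le_pr_μβ (GoodL P E i j used) (card_GoodL hK himp hu)]

/-- **[Garlík 2019, Lemma 14 (iv)], per level.** For `1 ≤ i < s`, the probability that `E` is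
not satisfied by `ρ(ω)` and at most `K₀` pairs of level `i` are `RL`-selected although more
than `W` pairs of level `i` are `L`-important in `E` is at most `(1 - p/4)^{W - 2K₀}`.
[cite: Garlik2019, Lemma 14 (iv)] -/
theorem pr_badL (hK : 16 * K₀ + 16 ≤ P.t) (W : ℕ) (E : Finset (Literal ℕ))
    {i : ℕ} (h1 : 1 ≤ i) (hi : i < P.s) :
    π.dist.pr (fun ω => ¬ SatBy P (rho P Fc K₀ ω) E ∧ W < (impL P E i).card ∧
        (selSet P ω.2 i).card ≤ K₀) ≤ (1 - π.p / 4) ^ (W - 2 * K₀) := by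
  classical
  have hq0 : 0 ≤ 1 - π.p / 4 := by linarith [π.p_le_one]
  have hq1 : 1 - π.p / 4 ≤ 1 := by linarith [π.p_nonneg]
  haveI : Nonempty (Bool × (Fin P.t × Fin P.t)) := ⟨(false, ⟨0, π.t_pos⟩, ⟨0, π.t_pos⟩)⟩
  apply pr_dist_le_RL
  intro x
  apply pr_distRL_le_level π ⟨i, hi⟩
  intro g₀
  -- the free important positions (children of level `i+1` and the last pair removed)
  set M' : Finset ℕ := impL P E i \ (B P K₀ g₀ i ∪ lastSet P i) with hM'
  set U : Finset (Fin P.t) := posSet P M' with hU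
  by_cases hW : W < (impL P E i).card
  swap
  · refine le_trans (FinProb.pr_mono _ (B := fun _ => False) fun lv hlv => hW hlv.2.1) ?_
    refine le_trans ?_ (pow_nonneg hq0 _)
    rw [FinProb.pr_eq_ex]; simp [FinProb.ex_const]
  have hUc : W - 2 * K₀ ≤ U.card := by
    have hXc : (B P K₀ g₀ i ∪ lastSet P i).card ≤ 2 * K₀ + 1 :=
      (Finset.card_union_le _ _).trans (Nat.add_le_add (card_B_le K₀ g₀ i) (card_lastSet_le i))
    have h1' := le_card_sdiff_of_le hW hXc
    have h2' := le_card_posSet (P := P) (M := M') π.t_pos fun j hj => by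
      simp only [hM', mem_sdiff, impL, mem_filter, mem_range] at hj; exact hj.1.1
    rw [hU]; rw [hM'] at h2' ⊢; omega
  have hUspec : ∀ j : Fin P.t, j ∈ U → LImp P E i j ∧ (j : ℕ) ∉ B P K₀ g₀ i ∧ ¬ IsLast P i j := by
    intro j hj
    rw [hU, mem_posSet] at hj
    simp only [hM', mem_sdiff, mem_union, not_or, impL, mem_filter, mem_range, lastSet] at hj
    exact ⟨hj.1.2, hj.2.1, fun hl => hj.2.2 ⟨j.is_lt, hl⟩⟩
  -- containment in the adapted events
  refine le_trans (FinProb.pr_mono _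
    (B := fun lv => ∀ j ∈ U, FL P E K₀ (Function.update g₀ ⟨i, hi⟩ lv) i j) ?_) ?_
  · rintro lv ⟨hns, -, hcnt⟩ j hj
    obtain ⟨himp, hB, hnl⟩ := hUspec j hj
    set g := Function.update g₀ ⟨i, hi⟩ lv with hg
    refine ⟨(countBefore_le_card_selSet g i j.is_lt.le).trans hcnt, fun hsucc => ?_⟩
    obtain ⟨hsel, hsat, hfL, hfR, hne⟩ := hsucc
    -- `j` survives, is kept, and its `L`-premise is set to the good child
    have hS : (j : ℕ) ∈ S P K₀ g i := by
      unfold S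
      rw [if_neg (not_lt.2 hcnt)]
      simp only [mem_filter, mem_range]
      exact ⟨j.is_lt, hsel, hfL, hfR, hne⟩
    have hKp : (j : ℕ) ∈ Kp P K₀ g i := by
      rw [mem_Kp]
      refine ⟨hS, ?_⟩
      rw [hg, B_update_self]; exact hB
    have hL : (rho P Fc K₀ (x, g)).L (i, j) = some (cL P g i j) := by
      rw [rho_L]
      simp [h1, hi, j.is_lt, hKp]
    obtain ⟨k', hk', c, hE, hdec⟩ := hsat
    exact hns ⟨_, _, hE, by rw [PA.eval_L hL h1 hi j.is_lt hk', hdec]⟩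
  · refine (FinProb.pr_seq_le π.μβ hq0 P.t U (fun j lv => FL P E K₀ (Function.update g₀ ⟨i, hi⟩ lv) i j)
      ?_ ?_).trans (pow_le_pow_of_le_one hq0 hq1 hUc)
    · -- adaptedness
      intro j lv lv' hagree
      have hb := before_update_agree g₀ hi (lv := lv) (lv' := lv') (j := j)
        fun k hk => hagree k hk.le
      have hl := level_update_agree g₀ hi hagree (le_refl (j : ℕ))
      unfold FL SuccL
      rw [hb.1, hb.2, hl.1, hl.2.1, hl.2.2]
    · -- the conditional bound
      intro j hj lv
      obtain ⟨himp, -, hnl⟩ := hUspec j hj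
      exact pr_FL_update π hK g₀ h1 hi j himp hnl lv

/-! #### The same for `R` -/

/-- "Setting `R(i,j,·) := k` satisfies a literal of `E`". [cite: Garlik2019, Lemma 14 (proof
of (iv): the sets T_{i,j})] -/
def RSat (P : Params) (E : Finset (Literal ℕ)) (i j k : ℕ) : Prop :=
  ∃ k' < P.t, ∃ c : Bool, ((LRefVar.R i j k').code, c) ∈ E ∧ decide (k = k') = c

open Classical in
/-- The set `T_{i,j}` of good `R`-premises. [cite: Garlik2019, Lemma 14 (proof of (iv))] -/
noncomputable def GR (P : Params) (E : Finset (Literal ℕ)) (i j : ℕ) : Finset (Fin P.t) :=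
  univ.filter fun x => RSat P E i j x

/-- `|T_{i,j}| ≥ t/2` at an `R`-important pair (`t ≥ 2`). [cite: Garlik2019, Lemma 14 (proof
of (iv): "We know that |T_{i,j}| ≥ t/2")] -/
theorem card_GR (ht2 : 2 ≤ P.t) {E : Finset (Literal ℕ)} {i j : ℕ} (h : RImp P E i j) :
    P.t ≤ 2 * (GR P E i j).card := by
  classical
  rcases h.2.2.2 with ⟨k₀, hk₀, hneg⟩ | hpos
  · have hsub : univ.erase (⟨k₀, hk₀⟩ : Fin P.t) ⊆ GR P E i j := by
      intro x hx
      rw [mem_erase] at hx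
      simp only [GR, mem_filter, mem_univ, true_and]
      refine ⟨k₀, hk₀, false, hneg, ?_⟩
      have : (x : ℕ) ≠ k₀ := fun he => hx.1 (Fin.ext he)
      simp [this]
    have := Finset.card_le_card hsub
    rw [Finset.card_erase_of_mem (mem_univ _), card_univ, Fintype.card_fin] at this
    omega
  · set Pos := (Finset.range P.t).filter fun k' => ((LRefVar.R i j k').code, true) ∈ E with hPos
    have hcnt : posCnt E (fun k => .R i j k) P.t = Pos.card := rfl
    have hsub : finFilter P.t Pos ⊆ GR P E i j := by
      intro x hx
      rw [mem_finFilter] at hx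
      simp only [hPos, mem_filter, mem_range] at hx
      simp only [GR, mem_filter, mem_univ, true_and]
      exact ⟨x, x.is_lt, true, hx.2, by simp⟩
    have h1 := Finset.card_le_card hsub
    have h2 := le_card_finFilter (N := P.t) (M := Pos) fun k hk => by
      simp only [hPos, mem_filter, mem_range] at hk; exact hk.1
    omega

/-- The success event at position `j` of level `i`: selected, fresh left child, good fresh
distinct right child. [cite: Garlik2019, Lemma 14 (proof of (iv))] -/
def SuccR (P : Params) (E : Finset (Literal ℕ)) (g : ΩRL P) (i j : ℕ) : Prop :=
  selRL P g i j = true ∧ RSat P E i j (cR P g i j) ∧ cL P g i j ∉ usedBefore P g i j ∧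
    cR P g i j ∉ usedBefore P g i j ∧ cL P g i j ≠ cR P g i j

/-- The adapted event at position `j`: few selections before `j`, and no success at `j`.
[cite: Garlik2019, Lemma 14 (proof of (iv), event (b))] -/
def FR (P : Params) (E : Finset (Literal ℕ)) (K₀ : ℕ) (g : ΩRL P) (i j : ℕ) : Prop :=
  countBefore P g i j ≤ K₀ ∧ ¬ SuccR P E g i j

/-- The good proposals at position `j` given the used children: fresh left child, good
fresh distinct right child. [cite: Garlik2019, Lemma 14 (proof of (iv))] -/
noncomputable def GoodR (P : Params) (E : Finset (Literal ℕ)) (i j : ℕ) (used : Finset ℕ) :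
    Finset (Fin P.t × Fin P.t) :=
  by classical exact
  ((univ \ finFilter P.t used) ×ˢ (GR P E i j \ finFilter P.t used)).filter fun c => c.1 ≠ c.2

/-- The good proposals are at least a quarter of all pairs when `|used| ≤ 2K₀`,
`16K₀ + 16 ≤ t` and `(i,j)` is `R`-important. [cite: Garlik2019, Lemma 14 (proof of (iv):
"(t/2 - 4pt)/t = (1-8p)/2 ≥ 1/3", here 1/4)] -/
theorem card_GoodR (hK : 16 * K₀ + 16 ≤ P.t) {E : Finset (Literal ℕ)} {i j : ℕ} (h : RImp P E i j)
    {used : Finset ℕ} (hu : used.card ≤ 2 * K₀) :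
    P.t * P.t ≤ 4 * (GoodR P E i j used).card := by
  classical
  set A₁ := GR P E i j \ finFilter P.t used with hA₁
  set A₂ := (univ : Finset (Fin P.t)) \ finFilter P.t used with hA₂
  have hfin : (finFilter P.t used).card ≤ 2 * K₀ :=
    (Finset.card_le_card_of_injOn (fun x : Fin P.t => (x : ℕ)) (fun x hx => by
      simpa [finFilter] using hx) (fun x _ y _ hxy => Fin.ext hxy)).trans hu
  have hT := card_GR (by omega) h
  have ha : P.t ≤ 2 * A₁.card + 4 * K₀ := by
    have := Finset.le_card_sdiff (finFilter P.t used) (GR P E i j)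
    rw [hA₁]; omega
  have hb : P.t ≤ A₂.card + 2 * K₀ := by
    have := Finset.le_card_sdiff (finFilter P.t used) (univ : Finset (Fin P.t))
    rw [card_univ, Fintype.card_fin] at this
    rw [hA₂]; omega
  have hat : A₁.card ≤ P.t := (card_le_univ _).trans (by simp)
  have hbt : A₂.card ≤ P.t := (card_le_univ _).trans (by simp)
  have hpairs := card_pairs_ge A₂ A₁
  have := (quarter_arith hK ha hb hat hbt).2
  unfold GoodR
  rw [← hA₁, ← hA₂]
  omega

/-- **The conditional bound**: given the level below `j` (with at most `K₀` selections before
`j`), the adapted event at an `R`-important, in-range position `j` has probability at most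
`1 - p/4`. [cite: Garlik2019, Lemma 14 (proof of (iv): "the probability … is at least 1/3")] -/
theorem pr_FR_update (hK : 16 * K₀ + 16 ≤ P.t) {E : Finset (Literal ℕ)} (g₀ : ΩRL P) {i : ℕ}
    (h1 : 1 ≤ i) (hi : i < P.s) (j : Fin P.t) (himp : RImp P E i j) (hnl : ¬ IsLast P i j)
    (lv : Fin P.t → Bool × (Fin P.t × Fin P.t)) :
    π.μβ.pr (fun a => FR P E K₀ (Function.update g₀ ⟨i, hi⟩ (Function.update lv j a)) i j) ≤
      1 - π.p / 4 := by
  classical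
  set g := Function.update g₀ ⟨i, hi⟩ lv with hg
  -- what is seen below `j` does not depend on the value at `j`
  have hbefore : ∀ a, usedBefore P (Function.update g₀ ⟨i, hi⟩ (Function.update lv j a)) i j =
      usedBefore P g i j ∧ countBefore P (Function.update g₀ ⟨i, hi⟩ (Function.update lv j a)) i j =
      countBefore P g i j := fun a =>
    before_update_agree g₀ hi fun k hk => Function.update_of_ne (ne_of_lt hk) _ _
  have hat : ∀ a : Bool × (Fin P.t × Fin P.t),
      selRL P (Function.update g₀ ⟨i, hi⟩ (Function.update lv j a)) i j = a.1 ∧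
      cL P (Function.update g₀ ⟨i, hi⟩ (Function.update lv j a)) i j = (a.2.1 : ℕ) ∧
      cR P (Function.update g₀ ⟨i, hi⟩ (Function.update lv j a)) i j = (a.2.2 : ℕ) := by
    intro a
    have := level_update_eq g₀ h1 hi j.is_lt hnl (Function.update lv j a)
    simpa using this
  by_cases hcnt : countBefore P g i j ≤ K₀
  swap
  · -- the event is empty
    refine le_trans (FinProb.pr_mono _ (B := fun _ => False) fun a ha => hcnt ?_) ?_
    · rw [← (hbefore a).2]; exact ha.1
    · rw [FinProb.pr_eq_ex]
      simp only [if_false]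
      rw [FinProb.ex_const]
      linarith [π.p_le_one]
  · set used := usedBefore P g i j with hused
    have hu : used.card ≤ 2 * K₀ := (card_usedBefore_le g i j).trans (by omega)
    -- the event implies that the proposal is not good
    refine le_trans (FinProb.pr_mono _
      (B := fun a => ¬ (a.1 = true ∧ a.2 ∈ GoodR P E i j used)) fun a ha hgood => ?_) ?_
    · apply ha.2
      obtain ⟨hs, hcl, hcr⟩ := hat a
      refine ⟨hs.trans hgood.1, ?_, ?_, ?_, ?_⟩
      · rw [hcr]
        have := hgood.2
        simp only [GoodR, mem_filter, mem_product, mem_sdiff, GR, mem_univ, true_and] at this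
        exact this.1.2.1
      · rw [hcl, (hbefore a).1]
        have := hgood.2
        simp only [GoodR, mem_filter, mem_product, mem_sdiff, mem_finFilter] at this
        exact this.1.1.2
      · rw [hcr, (hbefore a).1]
        have := hgood.2
        simp only [GoodR, mem_filter, mem_product, mem_sdiff, mem_finFilter] at this
        exact this.1.2.2
      · rw [hcl, hcr]
        have := hgood.2
        simp only [GoodR, mem_filter] at this
        exact fun he => this.2 (Fin.ext he)
    · rw [FinProb.pr_not]
      linarith [π.le_pr_μβ (GoodR P E i j used) (card_GoodR hK himp hu)]

/-- **[Garlík 2019, Lemma 14 (v)], per level.** For `1 ≤ i < s`, the probability that `E` is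
not satisfied by `ρ(ω)` and at most `K₀` pairs of level `i` are `RL`-selected although more
than `W` pairs of level `i` are `R`-important in `E` is at most `(1 - p/4)^{W - 2K₀}`.
[cite: Garlik2019, Lemma 14 (v)] -/
theorem pr_badR (hK : 16 * K₀ + 16 ≤ P.t) (W : ℕ) (E : Finset (Literal ℕ))
    {i : ℕ} (h1 : 1 ≤ i) (hi : i < P.s) :
    π.dist.pr (fun ω => ¬ SatBy P (rho P Fc K₀ ω) E ∧ W < (impR P E i).card ∧
        (selSet P ω.2 i).card ≤ K₀) ≤ (1 - π.p / 4) ^ (W - 2 * K₀) := by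
  classical
  have hq0 : 0 ≤ 1 - π.p / 4 := by linarith [π.p_le_one]
  have hq1 : 1 - π.p / 4 ≤ 1 := by linarith [π.p_nonneg]
  haveI : Nonempty (Bool × (Fin P.t × Fin P.t)) := ⟨(false, ⟨0, π.t_pos⟩, ⟨0, π.t_pos⟩)⟩
  apply pr_dist_le_RL
  intro x
  apply pr_distRL_le_level π ⟨i, hi⟩
  intro g₀
  -- the free important positions (children of level `i+1` and the last pair removed)
  set M' : Finset ℕ := impR P E i \ (B P K₀ g₀ i ∪ lastSet P i) with hM'
  set U : Finset (Fin P.t) := posSet P M' with hU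
  by_cases hW : W < (impR P E i).card
  swap
  · refine le_trans (FinProb.pr_mono _ (B := fun _ => False) fun lv hlv => hW hlv.2.1) ?_
    refine le_trans ?_ (pow_nonneg hq0 _)
    rw [FinProb.pr_eq_ex]; simp [FinProb.ex_const]
  have hUc : W - 2 * K₀ ≤ U.card := by
    have hXc : (B P K₀ g₀ i ∪ lastSet P i).card ≤ 2 * K₀ + 1 :=
      (Finset.card_union_le _ _).trans (Nat.add_le_add (card_B_le K₀ g₀ i) (card_lastSet_le i))
    have h1' := le_card_sdiff_of_le hW hXc
    have h2' := le_card_posSet (P := P) (M := M') π.t_pos fun j hj => by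
      simp only [hM', mem_sdiff, impR, mem_filter, mem_range] at hj; exact hj.1.1
    rw [hU]; rw [hM'] at h2' ⊢; omega
  have hUspec : ∀ j : Fin P.t, j ∈ U → RImp P E i j ∧ (j : ℕ) ∉ B P K₀ g₀ i ∧ ¬ IsLast P i j := by
    intro j hj
    rw [hU, mem_posSet] at hj
    simp only [hM', mem_sdiff, mem_union, not_or, impR, mem_filter, mem_range, lastSet] at hj
    exact ⟨hj.1.2, hj.2.1, fun hl => hj.2.2 ⟨j.is_lt, hl⟩⟩
  -- containment in the adapted events
  refine le_trans (FinProb.pr_mono _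
    (B := fun lv => ∀ j ∈ U, FR P E K₀ (Function.update g₀ ⟨i, hi⟩ lv) i j) ?_) ?_
  · rintro lv ⟨hns, -, hcnt⟩ j hj
    obtain ⟨himp, hB, hnl⟩ := hUspec j hj
    set g := Function.update g₀ ⟨i, hi⟩ lv with hg
    refine ⟨(countBefore_le_card_selSet g i j.is_lt.le).trans hcnt, fun hsucc => ?_⟩
    obtain ⟨hsel, hsat, hfL, hfR, hne⟩ := hsucc
    -- `j` survives, is kept, and its `R`-premise is set to the good child
    have hS : (j : ℕ) ∈ S P K₀ g i := by
      unfold S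
      rw [if_neg (not_lt.2 hcnt)]
      simp only [mem_filter, mem_range]
      exact ⟨j.is_lt, hsel, hfL, hfR, hne⟩
    have hKp : (j : ℕ) ∈ Kp P K₀ g i := by
      rw [mem_Kp]
      refine ⟨hS, ?_⟩
      rw [hg, B_update_self]; exact hB
    have hL : (rho P Fc K₀ (x, g)).R (i, j) = some (cR P g i j) := by
      rw [rho_R]
      simp [h1, hi, j.is_lt, hKp]
    obtain ⟨k', hk', c, hE, hdec⟩ := hsat
    exact hns ⟨_, _, hE, by rw [PA.eval_R hL h1 hi j.is_lt hk', hdec]⟩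
  · refine (FinProb.pr_seq_le π.μβ hq0 P.t U (fun j lv => FR P E K₀ (Function.update g₀ ⟨i, hi⟩ lv) i j)
      ?_ ?_).trans (pow_le_pow_of_le_one hq0 hq1 hUc)
    · -- adaptedness
      intro j lv lv' hagree
      have hb := before_update_agree g₀ hi (lv := lv) (lv' := lv') (j := j)
        fun k hk => hagree k hk.le
      have hl := level_update_agree g₀ hi hagree (le_refl (j : ℕ))
      unfold FR SuccR
      rw [hb.1, hb.2, hl.1, hl.2.1, hl.2.2]
    · -- the conditional bound
      intro j hj lv
      obtain ⟨himp, -, hnl⟩ := hUspec j hj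
      exact pr_FR_update π hK g₀ h1 hi j himp hnl lv

end Prem

/-! ### The union bound: existence of a good sample -/

section Assembly

variable {P : Params} {Fc : ℕ → Finset (ℕ × Bool)} (π : ProbParams P) {K₀ W T : ℕ}

/-- If no width count of `E` is exceeded then `E` is narrow. [folklore] -/
theorem narrow_of_not_exceeded {E : Finset (Literal ℕ)}
    (hD : ∀ i < P.s, (menD P E i).card ≤ W) (hV : ∀ i < P.s, (impV P E i).card ≤ W)
    (hI : (impI P E).card ≤ W) (hL : ∀ i < P.s, (impL P E i).card ≤ W)
    (hR : ∀ i < P.s, (impR P E i).card ≤ W) (hIc : ∀ m < P.r, (icol P E m).card ≤ T)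
    (hVc : ∀ i < P.s, ∀ ℓ < P.n, 1 ≤ i → (vcol P E i ℓ).card ≤ T) : Narrow P W T E := by
  classical
  refine ⟨fun i => ?_, fun i => ?_, hI, fun i => ?_, fun i => ?_, fun m hm => hIc m hm,
    fun i ℓ h1 hi hℓ => hVc i hi ℓ hℓ h1⟩
  · by_cases hi : i < P.s
    · exact hD i hi
    · rw [Finset.filter_false_of_mem fun j _ (h : DMen P E i j) => hi h.1]; simp
  · by_cases hi : i < P.s
    · exact hV i hi
    · rw [Finset.filter_false_of_mem fun j _ (h : VImp P E i j) => hi h.2.1]; simp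
  · by_cases hi : i < P.s
    · exact hL i hi
    · rw [Finset.filter_false_of_mem fun j _ (h : LImp P E i j) => hi h.2.1]; simp
  · by_cases hi : i < P.s
    · exact hR i hi
    · rw [Finset.filter_false_of_mem fun j _ (h : RImp P E i j) => hi h.2.1]; simp

/-- Summing a constant bound over `range N`. [folklore] -/
theorem sum_range_le_mul {N : ℕ} {f : ℕ → ℝ} {c : ℝ} (h : ∀ i < N, f i ≤ c) :
    ∑ i ∈ Finset.range N, f i ≤ N * c := by
  calc ∑ i ∈ Finset.range N, f i ≤ ∑ _i ∈ Finset.range N, c :=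
        Finset.sum_le_sum fun i hi => h i (mem_range.1 hi)
    _ = N * c := by rw [Finset.sum_const, card_range, nsmul_eq_mul]

/-- The per-clause failure bound. [cite: Garlik2019, Lemma 14] -/
noncomputable def clauseBound (P : Params) (p : ℝ) (K₀ W T : ℕ) : ℝ :=
  2 * P.s * (1 - p / 2) ^ (W - 4 * K₀) + (1 - p / 2) ^ (W - 2 * K₀) +
    2 * P.s * (1 - p / 4) ^ (W - 2 * K₀) + P.r * (1 - p / P.r) ^ (T - 2 * K₀) +
    P.s * P.n * (1 - p / P.n) ^ (T - 4 * K₀)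

/-- The count failure bound. [cite: Garlik2019, Lemma 10] -/
noncomputable def countBound (P : Params) (p : ℝ) (K₀ : ℕ) : ℝ :=
  (3 * P.s + 1) * ((1 / 2) ^ (K₀ + 1) * Real.exp (p * P.t))

/-- **The bad event of a single clause**: `E` is neither satisfied nor narrow, while the
`I`- and `RL`-counts are small; its probability is at most `clauseBound`.
[cite: Garlik2019, Lemma 14] -/
theorem pr_badClause (hP : CoreHyp P Fc) (hn2 : 2 ≤ P.n) (hr2 : 2 ≤ P.r) (hK : 16 * K₀ + 16 ≤ P.t)
    (E : Finset (Literal ℕ)) :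
    π.dist.pr (fun ω => ¬ SatBy P (rho P Fc K₀ ω) E ∧ ¬ Narrow P W T E ∧
        (selISet P ω.1.2).card ≤ K₀ ∧ ∀ i < P.s, (selSet P ω.2 i).card ≤ K₀) ≤
      clauseBound P π.p K₀ W T := by
  classical
  set ρ := fun ω : Ω P => rho P Fc K₀ ω with hρ
  -- the seven ways to exceed a width count
  have himp : ∀ ω : Ω P, (¬ SatBy P (rho P Fc K₀ ω) E ∧ ¬ Narrow P W T E ∧
      (selISet P ω.1.2).card ≤ K₀ ∧ ∀ i < P.s, (selSet P ω.2 i).card ≤ K₀) →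
      (∃ i ∈ Finset.range P.s, ¬ SatBy P (rho P Fc K₀ ω) E ∧ W < (menD P E i).card ∧
          (i = 0 → (selISet P ω.1.2).card ≤ K₀)) ∨
      (∃ i ∈ Finset.range P.s, ¬ SatBy P (rho P Fc K₀ ω) E ∧ W < (impV P E i).card) ∨
      (¬ SatBy P (rho P Fc K₀ ω) E ∧ W < (impI P E).card) ∨
      (∃ i ∈ Finset.range P.s, ¬ SatBy P (rho P Fc K₀ ω) E ∧ W < (impL P E i).card ∧
          (selSet P ω.2 i).card ≤ K₀) ∨
      (∃ i ∈ Finset.range P.s, ¬ SatBy P (rho P Fc K₀ ω) E ∧ W < (impR P E i).card ∧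
          (selSet P ω.2 i).card ≤ K₀) ∨
      (∃ m ∈ Finset.range P.r, ¬ SatBy P (rho P Fc K₀ ω) E ∧ T < (icol P E m).card) ∨
      (∃ i ∈ Finset.range P.s, ∃ ℓ ∈ Finset.range P.n,
          1 ≤ i ∧ ¬ SatBy P (rho P Fc K₀ ω) E ∧ T < (vcol P E i ℓ).card) := by
    rintro ω ⟨hns, hnn, hIc, hRLc⟩
    by_contra hcon
    simp only [not_or, not_exists, not_and, mem_range, not_lt] at hcon
    obtain ⟨c1, c2, c3, c4, c5, c6, c7⟩ := hcon
    exact hnn (narrow_of_not_exceeded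
      (fun i hi => by by_contra hW; exact c1 i hi hns (not_le.1 hW) (fun _ => hIc))
      (fun i hi => c2 i hi hns) (c3 hns)
      (fun i hi => by by_contra hW; exact c4 i hi hns (not_le.1 hW) (hRLc i hi))
      (fun i hi => by by_contra hW; exact c5 i hi hns (not_le.1 hW) (hRLc i hi))
      (fun m hm => c6 m hm hns) (fun i hi ℓ hℓ h1 => c7 i hi ℓ hℓ h1 hns))
  -- numeric shorthands
  set a := (1 - π.p / 2) ^ (W - 4 * K₀) with ha
  set b := (1 - π.p / 2) ^ (W - 2 * K₀) with hb
  set c := (1 - π.p / 4) ^ (W - 2 * K₀) with hc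
  set d := (1 - π.p / P.r) ^ (T - 2 * K₀) with hd
  set e := (1 - π.p / P.n) ^ (T - 4 * K₀) with he
  have hc0 : 0 ≤ c := pow_nonneg (by linarith [π.p_le_one]) _
  have he0 : 0 ≤ e := by
    apply pow_nonneg
    have hnpos : (0 : ℝ) < P.n := by exact_mod_cast hP.one_le_n
    have : π.p / P.n ≤ 1 := by
      rw [div_le_one hnpos]; exact π.p_le_one.trans (by exact_mod_cast hP.one_le_n)
    linarith
  -- the seven bounds
  have e1 : π.dist.pr (fun ω => ∃ i ∈ Finset.range P.s, ¬ SatBy P (rho P Fc K₀ ω) E ∧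
      W < (menD P E i).card ∧ (i = 0 → (selISet P ω.1.2).card ≤ K₀)) ≤ P.s * a :=
    (FinProb.pr_exists_le _ _ _).trans (sum_range_le_mul fun i hi => pr_badD π hP W E hi)
  have e2 : π.dist.pr (fun ω => ∃ i ∈ Finset.range P.s, ¬ SatBy P (rho P Fc K₀ ω) E ∧
      W < (impV P E i).card) ≤ P.s * a :=
    (FinProb.pr_exists_le _ _ _).trans (sum_range_le_mul fun i hi => pr_badV π hP hn2 W E hi)
  have e3 : π.dist.pr (fun ω => ¬ SatBy P (rho P Fc K₀ ω) E ∧ W < (impI P E).card) ≤ b :=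
    pr_badI π hP hr2 W E
  have e4 : π.dist.pr (fun ω => ∃ i ∈ Finset.range P.s, ¬ SatBy P (rho P Fc K₀ ω) E ∧
      W < (impL P E i).card ∧ (selSet P ω.2 i).card ≤ K₀) ≤ P.s * c := by
    refine (FinProb.pr_exists_le _ _ _).trans (sum_range_le_mul fun i hi => ?_)
    rcases Nat.eq_zero_or_pos i with rfl | h1
    · refine le_trans (FinProb.pr_mono _ (B := fun _ => False) fun ω hω => ?_) ?_
      · have : impL P E 0 = ∅ :=
          Finset.filter_false_of_mem fun j _ (h : LImp P E 0 j) => absurd h.1 (by omega)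
        rw [this] at hω; simp at hω
      · rw [FinProb.pr_eq_ex]; simp [FinProb.ex_const, hc0]
    · exact pr_badL π hK W E h1 hi
  have e5 : π.dist.pr (fun ω => ∃ i ∈ Finset.range P.s, ¬ SatBy P (rho P Fc K₀ ω) E ∧
      W < (impR P E i).card ∧ (selSet P ω.2 i).card ≤ K₀) ≤ P.s * c := by
    refine (FinProb.pr_exists_le _ _ _).trans (sum_range_le_mul fun i hi => ?_)
    rcases Nat.eq_zero_or_pos i with rfl | h1
    · refine le_trans (FinProb.pr_mono _ (B := fun _ => False) fun ω hω => ?_) ?_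
      · have : impR P E 0 = ∅ :=
          Finset.filter_false_of_mem fun j _ (h : RImp P E 0 j) => absurd h.1 (by omega)
        rw [this] at hω; simp at hω
      · rw [FinProb.pr_eq_ex]; simp [FinProb.ex_const, hc0]
    · exact pr_badR π hK W E h1 hi
  have e6 : π.dist.pr (fun ω => ∃ m ∈ Finset.range P.r, ¬ SatBy P (rho P Fc K₀ ω) E ∧
      T < (icol P E m).card) ≤ P.r * d :=
    (FinProb.pr_exists_le _ _ _).trans (sum_range_le_mul fun m hm => pr_badIcol π hP T E hm)
  have e7 : π.dist.pr (fun ω => ∃ i ∈ Finset.range P.s, ∃ ℓ ∈ Finset.range P.n,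
      1 ≤ i ∧ ¬ SatBy P (rho P Fc K₀ ω) E ∧ T < (vcol P E i ℓ).card) ≤ P.s * (P.n * e) := by
    refine (FinProb.pr_exists_le _ _ _).trans (sum_range_le_mul fun i hi => ?_)
    refine (FinProb.pr_exists_le _ _ _).trans (sum_range_le_mul fun ℓ hℓ => ?_)
    rcases Nat.eq_zero_or_pos i with rfl | h1
    · refine le_trans (FinProb.pr_mono _ (B := fun _ => False) fun ω hω => ?_) ?_
      · exact absurd hω.1 (by omega)
      · rw [FinProb.pr_eq_ex]; simp [FinProb.ex_const, he0]
    · exact le_trans (FinProb.pr_mono _ fun ω hω => hω.2) (pr_badVcol π hP T E h1 hi hℓ)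
  have split7 : ∀ A₁ A₂ A₃ A₄ A₅ A₆ A₇ : Ω P → Prop,
      π.dist.pr (fun ω => A₁ ω ∨ A₂ ω ∨ A₃ ω ∨ A₄ ω ∨ A₅ ω ∨ A₆ ω ∨ A₇ ω) ≤
        π.dist.pr A₁ + π.dist.pr A₂ + π.dist.pr A₃ + π.dist.pr A₄ + π.dist.pr A₅ +
          π.dist.pr A₆ + π.dist.pr A₇ := by
    intro A₁ A₂ A₃ A₄ A₅ A₆ A₇
    have h1 := π.dist.pr_or_le A₁ (fun ω => A₂ ω ∨ A₃ ω ∨ A₄ ω ∨ A₅ ω ∨ A₆ ω ∨ A₇ ω)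
    have h2 := π.dist.pr_or_le A₂ (fun ω => A₃ ω ∨ A₄ ω ∨ A₅ ω ∨ A₆ ω ∨ A₇ ω)
    have h3 := π.dist.pr_or_le A₃ (fun ω => A₄ ω ∨ A₅ ω ∨ A₆ ω ∨ A₇ ω)
    have h4 := π.dist.pr_or_le A₄ (fun ω => A₅ ω ∨ A₆ ω ∨ A₇ ω)
    have h5 := π.dist.pr_or_le A₅ (fun ω => A₆ ω ∨ A₇ ω)
    have h6 := π.dist.pr_or_le A₆ A₇
    linarith
  refine le_trans (FinProb.pr_mono _ himp) ((split7 _ _ _ _ _ _ _).trans ?_)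
  unfold clauseBound
  rw [← ha, ← hb, ← hc, ← hd, ← he]
  nlinarith [e1, e2, e3, e4, e5, e6, e7]

/-- Out of range, the selection sets are empty. [folklore] -/
theorem selDSet_eq_empty (d : ΩD P) {i : ℕ} (hi : P.s ≤ i) : selDSet P d i = ∅ :=
  Finset.filter_false_of_mem fun j _ h => by
    unfold selD at h; split_ifs at h with hc
    · omega

/-- Out of range, the selection sets are empty. [folklore] -/
theorem selVSet_eq_empty (v : ΩV P) {i : ℕ} (hi : P.s ≤ i) : selVSet P v i = ∅ :=
  Finset.filter_false_of_mem fun j _ h => by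
    unfold selV at h; split_ifs at h with hc
    · omega

/-- **Existence of a good sample** ([Garlík 2019, §4]: "By (4) and by Lemmas 10, 12 and 14,
there is a restriction ρ satisfying all the assertions of the lemmas"). If
`countBound + |𝓔| · clauseBound < 1` then some sample has small counts and makes every clause
of `𝓔` satisfied by `ρ(ω)` or `(W,T)`-narrow. [cite: Garlik2019, Thm 7 (proof, the choice
of ρ after Lemma 14)] -/
theorem exists_good_sample (hP : CoreHyp P Fc) (hn2 : 2 ≤ P.n) (hr2 : 2 ≤ P.r)
    (hK : 16 * K₀ + 16 ≤ P.t) (𝓔 : Finset (Finset (Literal ℕ)))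
    (hbound : countBound P π.p K₀ + 𝓔.card * clauseBound P π.p K₀ W T < 1) :
    ∃ ω : Ω P, SmallCounts P K₀ ω ∧ ∀ E ∈ 𝓔, SatBy P (rho P Fc K₀ ω) E ∨ Narrow P W T E := by
  classical
  set Good : Ω P → Prop := fun ω => SmallCounts P K₀ ω ∧ (∀ i < P.s, (selSet P ω.2 i).card ≤ K₀) ∧
    ∀ E ∈ 𝓔, SatBy P (rho P Fc K₀ ω) E ∨ Narrow P W T E with hGood
  -- the five ways to be bad
  have himp : ∀ ω, ¬ Good ω →
      (∃ i ∈ Finset.range P.s, K₀ < (selDSet P ω.1.1.1 i).card) ∨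
      (∃ i ∈ Finset.range P.s, K₀ < (selVSet P ω.1.1.2 i).card) ∨
      (K₀ < (selISet P ω.1.2).card) ∨
      (∃ i ∈ Finset.range P.s, K₀ < (selSet P ω.2 i).card) ∨
      (∃ E ∈ 𝓔, ¬ SatBy P (rho P Fc K₀ ω) E ∧ ¬ Narrow P W T E ∧
          (selISet P ω.1.2).card ≤ K₀ ∧ ∀ i < P.s, (selSet P ω.2 i).card ≤ K₀) := by
    intro ω hω
    by_contra hcon
    simp only [not_or, not_exists, not_and, mem_range, not_lt] at hcon
    obtain ⟨c1, c2, c3, c4, c5⟩ := hcon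
    apply hω
    refine ⟨⟨fun i => ?_, fun i => ?_, c3⟩, c4, fun E hE => ?_⟩
    · by_cases hi : i < P.s
      · exact c1 i hi
      · rw [selDSet_eq_empty _ (not_lt.1 hi)]; simp
    · by_cases hi : i < P.s
      · exact c2 i hi
      · rw [selVSet_eq_empty _ (not_lt.1 hi)]; simp
    · by_contra hne
      rw [not_or] at hne
      exact c5 E hE hne.1 hne.2 c3 c4
  -- the union bound
  set c₀ := (1 / 2 : ℝ) ^ (K₀ + 1) * Real.exp (π.p * P.t) with hc₀
  have b1 : π.dist.pr (fun ω => ∃ i ∈ Finset.range P.s, K₀ < (selDSet P ω.1.1.1 i).card) ≤ P.s * c₀ :=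
    (FinProb.pr_exists_le _ _ _).trans (sum_range_le_mul fun i hi => pr_countD π K₀ hi)
  have b2 : π.dist.pr (fun ω => ∃ i ∈ Finset.range P.s, K₀ < (selVSet P ω.1.1.2 i).card) ≤ P.s * c₀ :=
    (FinProb.pr_exists_le _ _ _).trans (sum_range_le_mul fun i hi => pr_countV π K₀ hi)
  have b3 : π.dist.pr (fun ω => K₀ < (selISet P ω.1.2).card) ≤ c₀ := pr_countI π K₀
  have b4 : π.dist.pr (fun ω => ∃ i ∈ Finset.range P.s, K₀ < (selSet P ω.2 i).card) ≤ P.s * c₀ :=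
    (FinProb.pr_exists_le _ _ _).trans (sum_range_le_mul fun i hi => pr_countRL π K₀ hi)
  have b5 : π.dist.pr (fun ω => ∃ E ∈ 𝓔, ¬ SatBy P (rho P Fc K₀ ω) E ∧ ¬ Narrow P W T E ∧
      (selISet P ω.1.2).card ≤ K₀ ∧ ∀ i < P.s, (selSet P ω.2 i).card ≤ K₀) ≤
      𝓔.card * clauseBound P π.p K₀ W T := by
    refine (FinProb.pr_exists_le _ _ _).trans ?_
    calc ∑ E ∈ 𝓔, π.dist.pr (fun ω => ¬ SatBy P (rho P Fc K₀ ω) E ∧ ¬ Narrow P W T E ∧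
            (selISet P ω.1.2).card ≤ K₀ ∧ ∀ i < P.s, (selSet P ω.2 i).card ≤ K₀)
        ≤ ∑ _E ∈ 𝓔, clauseBound P π.p K₀ W T :=
          Finset.sum_le_sum fun E _ => pr_badClause π hP hn2 hr2 hK E
      _ = 𝓔.card * clauseBound P π.p K₀ W T := by rw [Finset.sum_const, nsmul_eq_mul]
  have split5 : ∀ A₁ A₂ A₃ A₄ A₅ : Ω P → Prop,
      π.dist.pr (fun ω => A₁ ω ∨ A₂ ω ∨ A₃ ω ∨ A₄ ω ∨ A₅ ω) ≤
        π.dist.pr A₁ + π.dist.pr A₂ + π.dist.pr A₃ + π.dist.pr A₄ + π.dist.pr A₅ := by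
    intro A₁ A₂ A₃ A₄ A₅
    have h1 := π.dist.pr_or_le A₁ (fun ω => A₂ ω ∨ A₃ ω ∨ A₄ ω ∨ A₅ ω)
    have h2 := π.dist.pr_or_le A₂ (fun ω => A₃ ω ∨ A₄ ω ∨ A₅ ω)
    have h3 := π.dist.pr_or_le A₃ (fun ω => A₄ ω ∨ A₅ ω)
    have h4 := π.dist.pr_or_le A₄ A₅
    linarith
  have hbad : π.dist.pr (fun ω => ¬ Good ω) < 1 := by
    refine lt_of_le_of_lt (le_trans (FinProb.pr_mono _ himp) ((split5 _ _ _ _ _).trans ?_)) hbound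
    unfold countBound
    rw [← hc₀]
    nlinarith [b1, b2, b3, b4, b5]
  obtain ⟨ω, hω⟩ := π.dist.exists_not_of_pr_lt_one hbad
  rw [not_not] at hω
  exact ⟨ω, hω.1, hω.2.2⟩

end Assembly






end LevelledRefCNF

end Literature.Computability.MetaComplexity
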